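import Literature.LinearAlgebra.TateResidue.TateResidue
import Literature.NumberTheory.DiophantineGeometry.FunctionFieldAdelesProofs
import Mathlib.FieldTheory.IsAlgClosed.Basic
import HarnessLib

/-!
# Residues on an algebraic function field: the residue theorem, the Weil differential `dy`, its
  divisor, and the Riemann–Hurwitz formula in characteristic `0` (Tate 1968, §§3–4)

## Part I. Local residues, locality and the residue theorem (Tate 1968, §3)

Third layer of the residue route (after `Literature.LinearAlgebra.TateResidue.FinitePotentTrace` and
`….TateResidue` — Tate's trace and abstract residue `res^V_A(f dg)`), now specialised to an algebraic
function field `F/K` (`IsAlgFunctionField K F`) and its adele space `𝒜 = Adele K F`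
(`FunctionFieldAdeles`, Stichtenoth §1.5), following J. Tate, *Residues of differentials on curves*,
§3 ("Algebraic curves"), with `V = 𝒜`, `A = 𝒜(0)` and `K = F` the principal adeles:

* `inE_adeleSubspace_mulLeft`: multiplication by `x ∈ F` lies in Tate's `E(𝒜(D))`
  (`x 𝒜(D) ≼ 𝒜(D)`: `nearlyLE_adeleSubspace`, i.e. `dim 𝒜(D')/𝒜(D) < ∞` for `D ≤ D'`, from
  `adeleEvalMap`);
* `adelicRes K x y = res_{𝒜(0)}(x dy)` and **the residue theorem** `adelicRes_eq_zero` — from the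
  abstract residue theorem `res_eq_zero_of_quasiCompl`, `dim 𝒜/(𝒜(0) + F) = g < ∞`
  (`finrank_adeleQuotient`, Stichtenoth Cor. 1.5.5) and `𝒜(0) ∩ F = L(0)` finite-dimensional;
* the **local residue** `PlaceOver.localRes K P f g = res_P(f dg) := res^F_{𝒪_P}(f dg)` (no
  completion is needed, by (R1)/(R2)), with `P.ball n = πⁿ𝒪_P`, `P.ballEval`, `nearlyLE_ball`
  (`πᵐ𝒪_P/πⁿ𝒪_P` finite-dimensional), `inE_intSubmodule_mulLeft`; the rules: bilinearity (Thm. 1, via (T4)),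
  (R2) `localRes_eq_zero_of_mem` (`f, g ∈ 𝒪_P`), `localRes_eq_zero_of_mem₃`, (R3)
  `localRes_zpow_self` (`res_P(gⁿ dg) = 0`, `n ≠ -1`), the Leibniz rule `localRes_mul_right`, and
  **(R4)** at a rational place: `IsRational.localRes_inv_uniformizer` (`res_P(π⁻¹ dπ) = 1`),
  `IsRational.localRes_uniformizer_zpow` (Tate's Thm. 2 for monomials);
* **locality** (Tate's Thm. 3): `Adele.supportedIn S = V_S`, `Adele.restrictTo`,
  `isCompl_supportedIn_compl` (`𝒜 = V_S ⊕ V_{Sᶜ}`), `res_inf_supportedIn_union` (additivity over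
  disjoint sets of places, from `res_eq_add_of_isCompl` + `res_eq_res_restrict`),
  `res_inf_supportedIn_singleton` (`res_{𝒜(0) ∩ V_{P}} = res_P` along `V_{P} ≅ F`, `res_conj`),
  `adelicRes_eq_sum` (`res_{𝒜(0)}(x dy) = Σ_{P ∈ S} res_P(x dy)` for any finite `S` containing the
  poles of `x` and `y`) and the **residue theorem in classical form** `sum_localRes_eq_zero`:
  `Σ_P res_P(x dy) = 0` (Corollary of Thm. 3; `K` the full constant field).

## Part II. The Weil differential `dy` of an element, its divisor, and the Riemann–Hurwitz
  formula (Tate 1968, §§3–4; Stichtenoth §§3.4–3.5, 4.3)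

For an algebraic function field `F/K` (continuing with the local residues of Part I):

* `d(gⁿ) = n gⁿ⁻¹ dg` for local residues (`PlaceOver.localRes_zpow_right`, all `n ∈ ℤ`);
* the **value** `PlaceOver.value P y = y(P) ∈ K` (the constant `c` with `y ≡ c (mod t𝒪_P)`; it exists
  at rational places: `IsRational.sub_value_mem`) and the **order of `dy`**
  `PlaceOver.diffOrd P y = v_P(y - y(P)) - 1` (finite place; `= e_P - 1`) resp. `v_P(y) - 1` (pole;
  `= -e_P - 1`), with `diffOrd_of_sub_algebraMap_mem`, `diffOrd_of_not_mem`;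
* the **local expansion** `y = c + tⁿ u` (`n = diffOrd_P(y) + 1 ≠ 0`, `u` a unit, `u ≡ c_u`) at a
  rational place for `y ∉ K` (`IsRational.exists_expansion`), and **Tate's Thm. 2** in the form needed:
  `localRes_eq_zero_of_expansion` (`res_P(a dy) = 0` for `v_P(a) ≥ 1 - n`) and
  `localRes_zpow_neg_of_expansion` (`res_P(t⁻ⁿ dy) = n c_u`), from (R2)–(R4) and the Leibniz rule;
* the **Weil differential `dy`**: `weilDifferentialOfFun y = (α ↦ Σ_P res_P(α_P dy))`, a finite sum
  (`weilFun_eq_sum`), vanishing on `F` by the residue theorem (`weilDifferentialOfFun_algebraMap`) and on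
  `𝒜(-2(y)_∞)` (`weilDifferentialOfFun_mem`), whence `dOf K y : weilDifferential K F` with local
  components `dOf_single : dy(single_P a) = res_P(a dy)` (Tate §4, the map `c : Ω¹ → J`);
* **the divisor of `dy`** (`differentialDivisor_dOf_apply`): if `char K = 0`, `K` is the full constant
  field and every place of `F/K` is rational (e.g. `K` algebraically closed) and `y ∈ F ∖ K`, then
  `dy ≠ 0` (`dOf_ne_zero`) and `(dy)_P = diffOrd_P(y)` at **every** place; consequently `(dy)` is an
  explicit **canonical divisor**, `deg (dy) = 2g - 2`, `ℓ((dy)) = g`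
  (`isCanonical_differentialDivisor_dOf`), only finitely many places are ramified
  (`finite_setOf_diffOrd_ne_zero`), and the **Riemann–Hurwitz formula**
  `finsum_diffOrd_eq : Σ_P diffOrd_P(y) = 2g - 2`, i.e. `2g - 2 = -2[F : K(y)] + Σ_P (e_P - 1)`
  (Stichtenoth Cor. 3.4.14 with Dedekind's different theorem 3.5.1 (b) in the tame case);
* **consumable bounds**: `PlaceOver.le_diffOrd_of_sub_algebraMap_mem` (`y ≡ c (mod tⁿ) ⇒
  diffOrd_P(y) ≥ n - 1`), `IsRational.diffOrd_nonneg`, `diffOrd_of_ord_neg`; `sum_diffOrd_le` /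
  `le_genus_of_le_sum_diffOrd` (**genus lower bound** `2γ - 2 ≤ Σ_{P ∈ S} diffOrd_P(y) ⇒ γ ≤ g` for any
  finite `S` outside of which `y` is finite), `mem_riemannRochSpace_differentialDivisor_dOf_iff`
  (`x ∈ L((dy)) ↔ ∀ P, v_P(x) ≥ -diffOrd_P(y)`), `genus_le_finrank_of_injective` (an injective linear map
  `L((dy)) → V` gives `g ≤ dim V`); with explicit poles: `sum_neg_ord_le_finrank` and `mem_of_ord_neg`
  (a finite set `T` of poles with `Σ_{P ∈ T} -v_P(y) ≥ [F : K(y)]` contains every pole, Stichtenoth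
  Thm. 1.4.11), `le_genus_of_ramification` (`2γ - 2 ≤ Σ_{P ∈ S} diffOrd_P(y) - μ - #T ⇒ γ ≤ g` for
  `[F : K(y)] ≤ μ ≤ Σ_{P ∈ T} -v_P(y)`), `le_finrank_of_ramification_of_injective`; and for covers of
  the shape of `j : X₀(N) → ℙ¹` (`y ≡ a (mod t²)` on `S₂`, `y ≡ b (mod t³)` on `S₃`, poles `T`):
  `card_add_two_mul_card_le_genus` (`#S₂ + 2#S₃ - μ - #T ≤ 2g - 2`) and `le_finrank_of_cover₂₃`
  (`2#S₂ + ν₂ ≥ μ`, `3#S₃ + ν₃ ≥ μ`, `#T ≤ ν_∞`, `12γ + 3ν₂ + 4ν₃ + 6ν_∞ ≤ 12 + μ`, `L((dy)) ↪ V ⇒ γ ≤ dim V`);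
  dually, from **complete fibres** instead of ramification indices: `sum_neg_ord_eq_finrank`,
  `sum_ord_sub_eq_finrank` (`Σ_{P | a} v_P(y - a) = [F : K(y)] = Σ_{poles} -v_P(y)`, Thm. 1.4.11),
  `finrank_sub_card_le_genus` (`[F : K(y)] - #S_a - #S_b - #T ≤ 2g - 2` whenever `S_a`, `S_b`, `T`
  contain all places over `a`, `b`, `∞`) and `le_finrank_of_complete_fibres` (`μ ≤ [F : K(y)]`,
  `2#S_a ≤ μ + ν₂`, `3#S_b ≤ μ + 2ν₃`, `#T ≤ ν_∞`, genus formula `⇒ γ ≤ dim V`); and a **completeness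
  criterion for fibres** by the norm argument and weak approximation: `mem_of_monic_relation` (if every
  `u ≡ 1` at the places of `Ps` satisfies a monic relation with coefficients integral at all places over
  `c` and unit constant coefficient, then `Ps` contains all places over `c`), `mem_of_monic_relation_pole`,
  with `PlaceOver.aeval_sub_mem_ball`, `aeval_div_aeval_mem`, `valuation_aeval_div_aeval_eq_one`
  (`p(y)/q(y)`, `q(c) ≠ 0`, is integral at places over `c`, a unit if `p(c) ≠ 0`);
* over an **algebraically closed** `K` of characteristic `0`: `PlaceOver.isRational_of_isAlgClosed`,
  `isIntegrallyClosedIn_of_isAlgClosed`, `differentialDivisor_dOf_of_isAlgClosed` (all of the above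
  unconditionally) and the packaged `le_finrank_of_le_sum_diffOrd_of_injective` (`γ ≤ g ≤ dim V`),
  `le_finrank_of_ramification_of_injective_of_isAlgClosed`, `le_finrank_of_cover₂₃_of_isAlgClosed`,
  `le_finrank_of_complete_fibres_of_isAlgClosed`.

Intended use (modular curves: `EllipticCurves/ModularFunctionField*`, towards the named fact
`finrank_cuspForm_two_eq_genusX0` of `EllipticCurves/ModularCurve`): with
`F = K_N = Literature.ModularForms.modularFunctionField N` (an `IsAlgFunctionField ℂ K_N` with
`IsIntegrallyClosedIn ℂ K_N`), `y = j` (`kleinJL`), `T` = the cusp places (`-v_c(j)` = width, summing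
to `μ = [SL₂(ℤ) : Γ₀(N)] ≥ [K_N : ℂ(j)]`), `S` = the places `pointPlace τ` at the non-elliptic points
over `j = 1728` (`j - 1728 ∈ t²𝒪_P`, `diffOrd ≥ 1`) and `j = 0` (`diffOrd ≥ 2`), and `V = S₂(Γ₀(N))`
with `u ↦ u · j′` on `L((dj))` (membership read through
`mem_riemannRochSpace_differentialDivisor_dOf_iff`), `le_finrank_of_cover₂₃_of_isAlgClosed` (with
`a = 1728`, `b = 0`, `#S₂ = (μ - ν₂)/2`, `#S₃ = (μ - ν₃)/3`, `#T = ν_∞` and `twelve_mul_genusX0`) yields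
`genusX0 N ≤ dim S₂(Γ₀(N))`; alternatively `le_finrank_of_complete_fibres_of_isAlgClosed` with
`S_{1728}`, `S_0`, `T` all the places at the `Γ₀(N)`-orbits on `SL₂(ℤ)i`, `SL₂(ℤ)ρ`, `ℙ¹(ℚ)`
(`(μ + ν₂)/2`, `(μ + 2ν₃)/3`, `ν_∞` of them), given that every place of `K_N` over `1728`, `0`, `∞` is
one of them and `μ ≤ [K_N : ℂ(j)]`.

All declarations are new (Mathlib v4.32.0 has adeles of global fields via completions but no residues
of differentials; the tree's `FunctionFieldAdeles*` have no residues either), in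
`namespace Literature.AlgFunctionField` (and `….PlaceOver`, `….Adele`).

## References

* J. Tate, *Residues of differentials on curves*, Ann. Sci. École Norm. Sup. (4) 1 (1968), 149–159,
  §2 (R1)–(R4), §3 Thm. 2, Thm. 3 and Corollary, §4 Thm. 5. [Tate1968]
* H. Stichtenoth, *Algebraic Function Fields and Codes*, 2nd ed., GTM 254, Springer 2009, §1.5
  (adeles, Weil differentials), Thm. 1.1.6, Def. 1.1.14–1.1.15 (rational places, residue classes),
  Thm. 1.4.11, Cor. 1.5.16, Cor. 3.4.7, Cor. 3.4.14, Thm. 3.5.1, Cor. 3.5.5, Remark 4.3.7. [Stichtenoth2009]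
-/

noncomputable section

open scoped Classical IntermediateField
open Literature.LinearAlgebra.TateResidue.Tate Module

namespace Literature.NumberTheory.DiophantineGeometry.AlgFunctionField

universe u v

variable {K : Type u} {F : Type v} [Field K] [Field F] [Algebra K F]

/-! ### The adelic `E`-structure: `x · 𝒜(D) ≼ 𝒜(D)` -/

section adelic

variable [IsAlgFunctionField K F]

/-- `𝒜(D + P) ≼ 𝒜(D)`: the quotient is the residue field `F_P` (Stichtenoth Thm. 1.5.4, Step 1,
eq. (1.24)). [cite: Stichtenoth2009, Thm. 1.5.4 (proof, Step 1)] -/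
theorem nearlyLE_adeleSubspace_add_single (D : Divisor K F) (P : PlaceOver K F) :
    NearlyLE (adeleSubspace (D + Finsupp.single P 1)) (adeleSubspace D) := by
  haveI : FiniteDimensional K P.residueField := PlaceOver.finiteDimensional_residueField_holds P
  exact NearlyLE.of_linearMap_ker_le (adeleEvalMap P D) fun α hα ↦ (adeleEvalMap_eq_zero_iff P D α).1 hα

/-- `𝒜(D + nP) ≼ 𝒜(D)`. [cite: Stichtenoth2009, Thm. 1.5.4 (proof, Step 2)] -/
theorem nearlyLE_adeleSubspace_add_single_natCast (D : Divisor K F) (P : PlaceOver K F) (n : ℕ) :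
    NearlyLE (adeleSubspace (D + Finsupp.single P (n : ℤ))) (adeleSubspace D) := by
  induction n with
  | zero => simp only [Nat.cast_zero, Finsupp.single_zero, add_zero]; exact NearlyLE.refl _
  | succ n ih =>
    rw [Nat.cast_succ, Finsupp.single_add, ← add_assoc]
    exact (nearlyLE_adeleSubspace_add_single _ P).trans ih

/-- `D ≤ D' ⟹ 𝒜(D') ≼ 𝒜(D)`: `𝒜(D')/𝒜(D)` is finite-dimensional (Stichtenoth Thm. 1.5.4, Step 2,
eq. (1.25) without the principal adeles). [cite: Stichtenoth2009, Thm. 1.5.4 (proof, Step 2)] -/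
theorem nearlyLE_adeleSubspace {D D' : Divisor K F} (h : D ≤ D') :
    NearlyLE (adeleSubspace D') (adeleSubspace D) := by
  suffices H : ∀ E : Divisor K F, 0 ≤ E → ∀ D : Divisor K F,
      NearlyLE (adeleSubspace (D + E)) (adeleSubspace D) by
    simpa using H (D' - D) (sub_nonneg.2 h) D
  intro E
  induction E using Finsupp.induction with
  | zero => intro _ D; rw [add_zero]; exact NearlyLE.refl _
  | single_add a b f ha hb ih =>
    intro hE D
    have hfa : f a = 0 := Finsupp.notMem_support_iff.1 ha
    have hb' : 0 ≤ b := by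
      have := Finsupp.le_def.1 hE a
      simpa [hfa] using this
    have hf : 0 ≤ f := Finsupp.le_def.2 fun w ↦ by
      by_cases hw : a = w
      · subst hw; simp [hfa]
      · have := Finsupp.le_def.1 hE w
        simpa [Finsupp.single_apply, hw] using this
    obtain ⟨n, rfl⟩ := Int.eq_ofNat_of_zero_le hb'
    rw [add_comm (Finsupp.single a _) f, ← add_assoc]
    exact (nearlyLE_adeleSubspace_add_single_natCast (D + f) a n).trans (ih hf D)

/-- `x · 𝒜(D) ⊆ 𝒜(D - (x))` for `x ≠ 0` (Stichtenoth Def. 1.5.8). [cite: Stichtenoth2009, Def. 1.5.8] -/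
theorem map_mulLeft_adeleSubspace_le {x : F} (hx : x ≠ 0) (D : Divisor K F) :
    (adeleSubspace D).map (Adele.mulLeft x) ≤ adeleSubspace (D - principalDivisor K x) := by
  rintro _ ⟨α, hα, rfl⟩
  rw [Adele.mulLeft_apply]
  exact smul_mem_adeleSubspace hx (fun v ↦ by
    rw [Finsupp.coe_sub, Pi.sub_apply, principalDivisor_apply_of_ne_zero hx]; ring) hα

/-- Multiplication by `x ∈ F` lies in Tate's `E(𝒜(D))`: `x 𝒜(D) ≼ 𝒜(D)` (Tate 1968, §3: "`f A_p ≺ A_p`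
for all `f ∈ K_p`", adelically). [cite: Tate1968, §3] -/
theorem inE_adeleSubspace_mulLeft (D : Divisor K F) (x : F) :
    InE (adeleSubspace D) (Adele.mulLeft x) := by
  by_cases hx : x = 0
  · subst hx
    refine inE_of_map_le ?_
    rintro _ ⟨α, -, rfl⟩
    rw [Adele.mulLeft_apply, zero_smul]
    exact zero_mem _
  · exact ((nearlyLE_adeleSubspace (inf_le_right : D ⊓ (D - principalDivisor K x) ≤ _)).mono_left
      (map_mulLeft_adeleSubspace_le hx D)).mono_right (adeleSubspace_mono inf_le_left)

omit [IsAlgFunctionField K F] in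
/-- Multiplications by elements of `F` commute. [folklore] -/
theorem commute_mulLeft [IsAlgFunctionField K F] (x y : F) :
    Commute (Adele.mulLeft (K := K) x) (Adele.mulLeft y) := by
  ext α v
  simp [mul_left_comm]

/-- The principal adeles are an `F`-submodule. [cite: Stichtenoth2009, Def. 1.5.2] -/
theorem map_mulLeft_principalAdeles_le (x : F) :
    (principalAdeles K F).map (Adele.mulLeft x) ≤ principalAdeles K F := by
  rintro _ ⟨β, hβ, rfl⟩
  obtain ⟨y, rfl⟩ := (mem_principalAdeles_iff β).1 hβ
  rw [mem_principalAdeles_iff]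
  exact ⟨x * y, by rw [Adele.mulLeft_apply, Algebra.smul_def, map_mul]⟩

/-- `𝒜(0) ∩ F = L(0)` is finite-dimensional. [cite: Stichtenoth2009, Thm. 1.5.4 (proof, Step 2)] -/
instance finiteDimensional_adeleSubspace_inf_principalAdeles (D : Divisor K F) :
    FiniteDimensional K ↥(adeleSubspace D ⊓ principalAdeles K F) := by
  haveI : FiniteDimensional K (riemannRochSpace D) := finiteDimensional_riemannRochSpace_holds D
  refine Submodule.finiteDimensional_of_le (S₂ := (riemannRochSpace D).map
    ((Algebra.linearMap F (Adele K F)).restrictScalars K)) ?_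
  rintro α ⟨hα, hαF⟩
  obtain ⟨x, rfl⟩ := (mem_principalAdeles_iff α).1 hαF
  exact ⟨x, (algebraMap_mem_adeleSubspace_iff D x).1 hα, rfl⟩

/-- `𝒜 = 𝒜(0) + F` up to the finite-dimensional `H¹ = 𝒜/(𝒜(0) + F)` (Stichtenoth Cor. 1.5.5:
`dim = g`). [cite: Stichtenoth2009, Cor. 1.5.5] -/
theorem nearlyLE_top_adeleSubspace_sup_principalAdeles [IsIntegrallyClosedIn K F] (D : Divisor K F) :
    NearlyLE ⊤ (adeleSubspace D ⊔ principalAdeles K F) := by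
  haveI := (finrank_adeleQuotient (K := K) (F := F) D).1
  exact NearlyLE.top_of_finiteDimensional_quotient _

variable (K) in
/-- The **global (adelic) residue** `res_{𝒜(0)}(x dy)` of Tate 1968, §3 (proof of Thm. 3, with
`S` = all places, `A_S = 𝒜(0)`, `V_S = 𝒜`): Tate's abstract residue for `V = 𝒜_F`, `A = 𝒜_F(0)`
and the commuting operators "multiplication by `x`", "multiplication by `y`".
[cite: Tate1968, §3, Thm. 3] -/
def adelicRes (x y : F) : K :=
  res (adeleSubspace (0 : Divisor K F)) (Adele.mulLeft x) (Adele.mulLeft y)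

/-- **The residue theorem** (adelic form): `res_{𝒜(0)}(x dy) = 0` for all `x, y ∈ F` (Tate 1968,
§3, proof of Thm. 3 and its Corollary: `res_K = 0` since `F` is an `F`-module,
`res_{K + A} = 0` since `𝒜/(𝒜(0) + F)` is finite-dimensional, `res_{K ∩ A} = 0` since
`𝒜(0) ∩ F = L(0)` is finite-dimensional). Requires `K` to be the full constant field.
[cite: Tate1968, §3, Thm. 3, Corollary] -/
theorem adelicRes_eq_zero [IsIntegrallyClosedIn K F] (x y : F) : adelicRes K x y = 0 :=
  res_eq_zero_of_quasiCompl (inE_adeleSubspace_mulLeft 0 x) (inE_adeleSubspace_mulLeft 0 y)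
    (commute_mulLeft x y) (map_mulLeft_principalAdeles_le x) (map_mulLeft_principalAdeles_le y)
    (nearlyLE_top_adeleSubspace_sup_principalAdeles 0)

end adelic

/-! ### Local residues at a place -/

namespace PlaceOver

/-- The ball `{x ∈ F | v_P(x) ≥ n} = π_Pⁿ 𝒪_P` as a `K`-subspace of `F` (`n ∈ ℤ`), phrased through
the valuation as in `adeleSubspace`. [folklore] -/
def ball (P : PlaceOver K F) (n : ℤ) : Submodule K F where
  carrier := {x | P.valuation x ≤ P.valuation (P.uniformizer : F) ^ n}
  zero_mem' := by simp
  add_mem' {x y} hx hy := by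
    simp only [Set.mem_setOf_eq] at hx hy ⊢
    exact (Valuation.map_add _ x y).trans (max_le hx hy)
  smul_mem' c {x} hx := by
    simp only [Set.mem_setOf_eq] at hx ⊢
    rw [Algebra.smul_def, Valuation.map_mul]
    exact (mul_le_of_le_one_left' (P.toValuationSubring.valuation_le_one ⟨_, P.algebraMap_mem c⟩)).trans hx

/-- Membership in `P.ball n`. [folklore] -/
theorem mem_ball_iff (P : PlaceOver K F) (n : ℤ) (x : F) :
    x ∈ P.ball n ↔ P.valuation x ≤ P.valuation (P.uniformizer : F) ^ n :=
  Iff.rfl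

/-- For `x ≠ 0`: `x ∈ P.ball n ↔ n ≤ ord_P x`. [folklore] -/
theorem mem_ball_iff_le_ord [IsAlgFunctionField K F] (P : PlaceOver K F) (n : ℤ) {x : F}
    (hx : x ≠ 0) : x ∈ P.ball n ↔ n ≤ P.ord x :=
  P.valuation_le_zpow_iff_le_ord hx n

/-- `P.ball 0 = 𝒪_P`. [folklore] -/
theorem mem_ball_zero_iff (P : PlaceOver K F) (x : F) : x ∈ P.ball 0 ↔ x ∈ P.toValuationSubring := by
  rw [mem_ball_iff, zpow_zero]
  exact P.toValuationSubring.valuation_le_one_iff x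

/-- The balls decrease. [folklore] -/
theorem ball_antitone [IsAlgFunctionField K F] (P : PlaceOver K F) : Antitone P.ball :=
  fun _ _ h x hx ↦ (P.mem_ball_iff _ x).2 (((P.mem_ball_iff _ x).1 hx).trans
    (P.zpow_valuation_uniformizer_le_of_le h))

variable (K) in
/-- `𝒪_P` as a `K`-subspace of `F`. [folklore] -/
abbrev intSubmodule (P : PlaceOver K F) : Submodule K F :=
  P.ball 0

/-- `x · P.ball n ⊆ P.ball (n + ord_P x)` for `x ≠ 0`. [folklore] -/
theorem map_mulLeft_ball_le [IsAlgFunctionField K F] (P : PlaceOver K F) {x : F} (hx : x ≠ 0)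
    (n : ℤ) : (P.ball n).map (LinearMap.mulLeft K x) ≤ P.ball (n + P.ord x) := by
  rintro _ ⟨y, hy, rfl⟩
  rw [LinearMap.mulLeft_apply, mem_ball_iff, Valuation.map_mul, P.valuation_eq_zpow_ord hx, zpow_add₀
    P.valuation_uniformizer_ne_zero, mul_comm (P.valuation (P.uniformizer : F) ^ n)]
  exact mul_le_mul_right ((P.mem_ball_iff _ _).1 hy) _

/-- For `y ∈ P.ball n`: `y π^{-n} ∈ 𝒪_P`. [folklore] -/
theorem mul_uniformizer_zpow_neg_mem (P : PlaceOver K F) (n : ℤ) {y : F} (hy : y ∈ P.ball n) :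
    y * (P.uniformizer : F) ^ (-n) ∈ P.toValuationSubring := by
  rw [← P.toValuationSubring.valuation_le_one_iff]
  change P.valuation _ ≤ 1
  rw [Valuation.map_mul, map_zpow₀]
  calc P.valuation y * P.valuation (P.uniformizer : F) ^ (-n)
      ≤ P.valuation (P.uniformizer : F) ^ n * P.valuation (P.uniformizer : F) ^ (-n) :=
        mul_le_mul_left ((P.mem_ball_iff n y).1 hy) _
    _ = 1 := by rw [← zpow_add₀ P.valuation_uniformizer_ne_zero, add_neg_cancel, zpow_zero]

/-- The local evaluation `P.ball n → F_P`, `y ↦ (π^{-n} y)(P)`, whose kernel is `P.ball (n+1)`.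
[folklore] -/
def ballEval [IsAlgFunctionField K F] (P : PlaceOver K F) (n : ℤ) : P.ball n →ₗ[K] P.residueField where
  toFun y := IsLocalRing.residue P.toValuationSubring
    ⟨(y : F) * (P.uniformizer : F) ^ (-n), P.mul_uniformizer_zpow_neg_mem n y.2⟩
  map_add' y z := by
    rw [← map_add]
    congr 1
    ext
    simp [add_mul]
  map_smul' c y := by
    rw [RingHom.id_apply, Algebra.smul_def, PlaceOver.algebraMap_residueField_apply, ← map_mul]
    congr 1
    ext
    simp only [Submodule.coe_smul, MulMemClass.coe_mul, PlaceOver.algebraMap_toValuationSubring_apply,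
      Algebra.smul_def, mul_assoc]

/-- The kernel of `ballEval` is the next ball. [folklore] -/
theorem ballEval_eq_zero_iff [IsAlgFunctionField K F] (P : PlaceOver K F) (n : ℤ) (y : P.ball n) :
    P.ballEval n y = 0 ↔ (y : F) ∈ P.ball (n + 1) := by
  rw [ballEval, LinearMap.coe_mk, AddHom.coe_mk, IsLocalRing.residue_eq_zero_iff,
    ValuationSubring.valuation_lt_one_iff, PlaceOver.valuation_lt_one_iff_le]
  change P.valuation ((y : F) * (P.uniformizer : F) ^ (-n)) ≤ _ ↔ _
  rw [mem_ball_iff, Valuation.map_mul, map_zpow₀, zpow_neg,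
    mul_inv_le_iff₀ (zpow_pos (zero_lt_iff.2 P.valuation_uniformizer_ne_zero) n),
    mul_comm (P.valuation (P.uniformizer : F)), ← zpow_add_one₀ P.valuation_uniformizer_ne_zero]

/-- `P.ball n ≼ P.ball (n + 1)` (the quotient is `F_P`). [folklore] -/
theorem nearlyLE_ball_succ [IsAlgFunctionField K F] (P : PlaceOver K F) (n : ℤ) :
    NearlyLE (P.ball n) (P.ball (n + 1)) := by
  haveI : FiniteDimensional K P.residueField := PlaceOver.finiteDimensional_residueField_holds P
  exact NearlyLE.of_linearMap_ker_le (P.ballEval n) fun y hy ↦ (P.ballEval_eq_zero_iff n y).1 hy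

/-- `P.ball m ≼ P.ball (m + k)`. [folklore] -/
theorem nearlyLE_ball_add_natCast [IsAlgFunctionField K F] (P : PlaceOver K F) (m : ℤ) (k : ℕ) :
    NearlyLE (P.ball m) (P.ball (m + k)) := by
  induction k with
  | zero => rw [Nat.cast_zero, add_zero]; exact NearlyLE.refl _
  | succ k ih => rw [Nat.cast_succ, ← add_assoc]; exact ih.trans (P.nearlyLE_ball_succ _)

/-- `P.ball m ≼ P.ball n` for all `m, n`: all the quotients `πᵐ𝒪_P/πⁿ𝒪_P` are
finite-dimensional (Tate 1968, §3: "`A_p ∼ t_pⁿ A_p` for all integers `n`"). [cite: Tate1968, §3] -/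
theorem nearlyLE_ball [IsAlgFunctionField K F] (P : PlaceOver K F) (m n : ℤ) :
    NearlyLE (P.ball m) (P.ball n) := by
  rcases le_or_gt n m with h | h
  · exact NearlyLE.of_le (P.ball_antitone h)
  · obtain ⟨k, hk⟩ := Int.eq_ofNat_of_zero_le (sub_nonneg.2 h.le)
    rw [show n = m + k by omega]
    exact P.nearlyLE_ball_add_natCast m k

/-- Multiplication by `x ∈ F` lies in Tate's `E(𝒪_P)`: `x 𝒪_P ≼ 𝒪_P` (Tate 1968, §3: "`fA_p ≺ A_p`
for all `f ∈ K_p`"). [cite: Tate1968, §3] -/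
theorem inE_intSubmodule_mulLeft [IsAlgFunctionField K F] (P : PlaceOver K F) (x : F) :
    InE (P.intSubmodule K) (LinearMap.mulLeft K x) := by
  by_cases hx : x = 0
  · subst hx
    refine inE_of_map_le ?_
    rintro _ ⟨y, -, rfl⟩
    rw [LinearMap.mulLeft_apply, zero_mul]
    exact zero_mem _
  · exact (P.nearlyLE_ball (0 + P.ord x) 0).mono_left (P.map_mulLeft_ball_le hx 0)

omit [Algebra K F] in
/-- Multiplications commute. [folklore] -/
theorem commute_mulLeft [Algebra K F] (x y : F) : Commute (LinearMap.mulLeft K x) (LinearMap.mulLeft K y) := by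
  ext z; simp [mul_left_comm]

/-- `𝒪_P` is stable under multiplication by its elements. [folklore] -/
theorem map_mulLeft_intSubmodule_le (P : PlaceOver K F) {x : F} (hx : x ∈ P.toValuationSubring) :
    (P.intSubmodule K).map (LinearMap.mulLeft K x) ≤ P.intSubmodule K := by
  rintro _ ⟨y, hy, rfl⟩
  rw [LinearMap.mulLeft_apply]
  exact (P.mem_ball_zero_iff _).2 (mul_mem hx ((P.mem_ball_zero_iff y).1 hy))

variable (K) in
/-- **The local residue `res_P(f dg) ∈ K`** of `f, g ∈ F` at the place `P`: Tate's residue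
`res^V_A(f dg)` for `V = F`, `A = 𝒪_P` (as `K`-spaces) and the multiplication operators by `f` and
`g` (Tate 1968, §3, Definition before Thm. 2, where `V = K_p`, `A = 𝒪̂_p`; by (R1)/(R2) the
completion is immaterial, and we never complete). For a rational place and a local parameter `t`
this is the coefficient of `t⁻¹` in `f dg/dt` (Thm. 2; see `FunctionFieldResiduesLocal`).
[cite: Tate1968, §3, Thm. 2] -/
def localRes [IsAlgFunctionField K F] (P : PlaceOver K F) (f g : F) : K :=
  res (P.intSubmodule K) (LinearMap.mulLeft K f) (LinearMap.mulLeft K g)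

section localRes

variable [IsAlgFunctionField K F] (P : PlaceOver K F)

omit [IsAlgFunctionField K F] in
/-- `mulLeft` is additive. [folklore] -/
theorem mulLeft_add' (f f' : F) : LinearMap.mulLeft K (f + f') = LinearMap.mulLeft K f + LinearMap.mulLeft K f' := by
  ext; simp [add_mul]

omit [IsAlgFunctionField K F] in
/-- `mulLeft` is `K`-homogeneous. [folklore] -/
theorem mulLeft_smul' (c : K) (f : F) : LinearMap.mulLeft K (c • f) = c • LinearMap.mulLeft K f := by
  ext; simp [Algebra.smul_def]

omit [IsAlgFunctionField K F] in
/-- `mulLeft` is multiplicative. [folklore] -/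
theorem mulLeft_mul' (f g : F) : LinearMap.mulLeft K (f * g) = LinearMap.mulLeft K f * LinearMap.mulLeft K g :=
  LinearMap.mulLeft_mul K F f g

/-- `res_P((f + f') dg) = res_P(f dg) + res_P(f' dg)`. [cite: Tate1968, §2, Thm. 1] -/
theorem localRes_add_left (f f' g : F) :
    P.localRes K (f + f') g = P.localRes K f g + P.localRes K f' g := by
  rw [localRes, mulLeft_add']
  exact res_add_left (P.inE_intSubmodule_mulLeft f) (P.inE_intSubmodule_mulLeft f')
    (P.inE_intSubmodule_mulLeft g) (commute_mulLeft f g) (commute_mulLeft f' g)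

/-- `res_P(f d(g + g')) = res_P(f dg) + res_P(f dg')`. [cite: Tate1968, §2, Thm. 1] -/
theorem localRes_add_right (f g g' : F) :
    P.localRes K f (g + g') = P.localRes K f g + P.localRes K f g' := by
  rw [localRes, mulLeft_add']
  exact res_add_right (P.inE_intSubmodule_mulLeft f) (P.inE_intSubmodule_mulLeft g)
    (P.inE_intSubmodule_mulLeft g') (commute_mulLeft f g) (commute_mulLeft f g')

/-- `res_P((c f) dg) = c res_P(f dg)` for a constant `c`. [cite: Tate1968, §2, Thm. 1] -/
theorem localRes_smul_left (c : K) (f g : F) : P.localRes K (c • f) g = c * P.localRes K f g := by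
  rw [localRes, mulLeft_smul']
  exact res_smul_left c (P.inE_intSubmodule_mulLeft f) (P.inE_intSubmodule_mulLeft g) (commute_mulLeft f g)

/-- `res_P(f d(c g)) = c res_P(f dg)` for a constant `c`. [cite: Tate1968, §2, Thm. 1] -/
theorem localRes_smul_right (c : K) (f g : F) : P.localRes K f (c • g) = c * P.localRes K f g := by
  rw [localRes, mulLeft_smul']
  exact res_smul_right c (P.inE_intSubmodule_mulLeft f) (P.inE_intSubmodule_mulLeft g) (commute_mulLeft f g)

/-- `res_P(0 dg) = 0`. [folklore] -/
@[simp]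
theorem localRes_zero_left (g : F) : P.localRes K 0 g = 0 := by
  rw [localRes, show LinearMap.mulLeft K (0 : F) = 0 from (LinearMap.mulLeft_eq_zero_iff K F 0).2 rfl]
  exact res_zero_left _

/-- `res_P(f d0) = 0`. [folklore] -/
@[simp]
theorem localRes_zero_right (f : F) : P.localRes K f 0 = 0 := by
  rw [localRes, show LinearMap.mulLeft K (0 : F) = 0 from (LinearMap.mulLeft_eq_zero_iff K F 0).2 rfl]
  exact res_zero_right _

/-- `res_P(f d1) = 0`. [cite: Tate1968, §2, (R3)] -/
@[simp]
theorem localRes_one_right (f : F) : P.localRes K f 1 = 0 := by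
  rw [localRes, LinearMap.mulLeft_one]; exact res_one_right _

/-- `res_P((c) dg) = 0` for a constant `c ∈ K`: `res_P(dg) = 0`. [cite: Tate1968, §2, (R3)] -/
theorem localRes_algebraMap_left (c : K) (g : F) : P.localRes K (algebraMap K F c) g = 0 := by
  rw [Algebra.algebraMap_eq_smul_one, localRes_smul_left, localRes, LinearMap.mulLeft_one]
  rw [show (LinearMap.id : F →ₗ[K] F) = 1 from rfl, res_one_left (P.inE_intSubmodule_mulLeft g), mul_zero]

/-- `res_P(f dc) = 0` for a constant `c ∈ K`. [folklore] -/
theorem localRes_algebraMap_right (f : F) (c : K) : P.localRes K f (algebraMap K F c) = 0 := by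
  rw [Algebra.algebraMap_eq_smul_one, localRes_smul_right, localRes_one_right, mul_zero]

/-- `res_P((-f) dg) = -res_P(f dg)`. [cite: Tate1968, §2, Thm. 1] -/
theorem localRes_neg_left (f g : F) : P.localRes K (-f) g = -P.localRes K f g := by
  simpa using P.localRes_smul_left (-1) f g

/-- `res_P(f d(-g)) = -res_P(f dg)`. [cite: Tate1968, §2, Thm. 1] -/
theorem localRes_neg_right (f g : F) : P.localRes K f (-g) = -P.localRes K f g := by
  simpa using P.localRes_smul_right (-1) f g

/-- `res_P((f - f') dg) = res_P(f dg) - res_P(f' dg)`. [cite: Tate1968, §2, Thm. 1] -/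
theorem localRes_sub_left (f f' g : F) : P.localRes K (f - f') g = P.localRes K f g - P.localRes K f' g := by
  rw [sub_eq_add_neg, localRes_add_left, localRes_neg_left, sub_eq_add_neg]

/-- `res_P(f d(g - g')) = res_P(f dg) - res_P(f dg')`. [cite: Tate1968, §2, Thm. 1] -/
theorem localRes_sub_right (f g g' : F) : P.localRes K f (g - g') = P.localRes K f g - P.localRes K f g' := by
  rw [sub_eq_add_neg, localRes_add_right, localRes_neg_right, sub_eq_add_neg]

/-- **Leibniz rule** `res_P(f d(gh)) = res_P(fg dh) + res_P(fh dg)`. [cite: Tate1968, §2, Thm. 1] -/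
theorem localRes_mul_right (f g h : F) :
    P.localRes K f (g * h) = P.localRes K (f * g) h + P.localRes K (f * h) g := by
  simp only [localRes, mulLeft_mul']
  exact res_mul_right (P.inE_intSubmodule_mulLeft f) (P.inE_intSubmodule_mulLeft g)
    (P.inE_intSubmodule_mulLeft h) (commute_mulLeft f g) (commute_mulLeft f h) (commute_mulLeft g h)

/-- `res_P(gⁿ dg) = 0` for `n ≥ 0`. [cite: Tate1968, §2, (R3)] -/
theorem localRes_pow_self (g : F) (n : ℕ) : P.localRes K (g ^ n) g = 0 := by
  rw [localRes, ← LinearMap.pow_mulLeft]; exact res_pow_self (P.inE_intSubmodule_mulLeft g) n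

/-- `res_P(g dg) = 0`. [cite: Tate1968, §2, (R3)] -/
theorem localRes_self (g : F) : P.localRes K g g = 0 := by simpa using P.localRes_pow_self g 1

/-- `res_P(g⁻ⁿ dg) = 0` for `n ≥ 2` (`g ≠ 0`). [cite: Tate1968, §2, (R3)] -/
theorem localRes_inv_pow (g : F) (hg : g ≠ 0) (n : ℕ) (hn : 2 ≤ n) : P.localRes K (g⁻¹ ^ n) g = 0 := by
  rw [localRes, ← LinearMap.pow_mulLeft]
  refine res_inv_pow (P.inE_intSubmodule_mulLeft g) (P.inE_intSubmodule_mulLeft g⁻¹) ?_ ?_ n hn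
  · rw [← mulLeft_mul', mul_inv_cancel₀ hg, LinearMap.mulLeft_one]; rfl
  · rw [← mulLeft_mul', inv_mul_cancel₀ hg, LinearMap.mulLeft_one]; rfl

/-- `res_P(gⁿ dg) = 0` for every integer `n ≠ -1` (`g ≠ 0`). [cite: Tate1968, §2, (R3)] -/
theorem localRes_zpow_self {g : F} (hg : g ≠ 0) {n : ℤ} (hn : n ≠ -1) : P.localRes K (g ^ n) g = 0 := by
  rcases le_or_gt 0 n with h | h
  · obtain ⟨k, rfl⟩ := Int.eq_ofNat_of_zero_le h
    rw [zpow_natCast]; exact P.localRes_pow_self g k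
  · obtain ⟨k, hk⟩ := Int.eq_ofNat_of_zero_le (by omega : 0 ≤ -n)
    rw [show n = -(k : ℤ) by omega, zpow_neg, zpow_natCast, ← inv_pow]
    exact P.localRes_inv_pow g hg k (by omega)

/-- **(R2)**: `res_P(f dg) = 0` if `f, g ∈ 𝒪_P` (Tate 1968, §2, (R2); §3, proof of Thm. 3:
"`res_p(f dg) = 0` for `p ∈ T`"). [cite: Tate1968, §2, (R2)] -/
theorem localRes_eq_zero_of_mem {f g : F} (hf : f ∈ P.toValuationSubring) (hg : g ∈ P.toValuationSubring) :
    P.localRes K f g = 0 :=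
  res_eq_zero_of_invariant (commute_mulLeft f g) (P.map_mulLeft_intSubmodule_le hf)
    (P.map_mulLeft_intSubmodule_le hg)

/-- **(R2)**, general form: `res_P(f dg) = 0` if `f, fg, fg² ∈ 𝒪_P`. [cite: Tate1968, §2, (R2)] -/
theorem localRes_eq_zero_of_mem₃ {f g : F} (h₁ : f ∈ P.toValuationSubring) (h₂ : f * g ∈ P.toValuationSubring)
    (h₃ : f * g * g ∈ P.toValuationSubring) : P.localRes K f g = 0 := by
  refine res_eq_zero_of_map_le (commute_mulLeft f g) (P.map_mulLeft_intSubmodule_le h₁) ?_ ?_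
  · rw [← mulLeft_mul']; exact P.map_mulLeft_intSubmodule_le h₂
  · rw [← mulLeft_mul', ← mulLeft_mul']; exact P.map_mulLeft_intSubmodule_le h₃

/-! #### (R4) at a rational place: `res_P(π⁻¹ dπ) = 1` -/

variable (K) in
/-- The constants `K ⊆ F` as a `K`-subspace. [folklore] -/
def constSubmodule : Submodule K F := LinearMap.range (Algebra.linearMap K F)

omit [IsAlgFunctionField K F] in
/-- `dim_K K = 1` inside `F`. [folklore] -/
theorem finrank_constSubmodule : finrank K (constSubmodule K (F := F)) = 1 := by
  rw [constSubmodule, LinearMap.finrank_range_of_inj (FaithfulSMul.algebraMap_injective K F),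
    Module.finrank_self]

omit [IsAlgFunctionField K F] in
/-- Constants are integral at every place. [folklore] -/
theorem constSubmodule_le_intSubmodule : constSubmodule K ≤ P.intSubmodule K := by
  rintro _ ⟨c, rfl⟩
  exact (P.mem_ball_zero_iff _).2 (P.algebraMap_mem c)

omit [IsAlgFunctionField K F] in
omit [IsAlgFunctionField K F] in
/-- A nonzero constant is not in `π 𝒪_P`. [folklore] -/
theorem disjoint_constSubmodule_map_uniformizer :
    Disjoint (constSubmodule K) ((P.intSubmodule K).map (LinearMap.mulLeft K (P.uniformizer : F))) := by
  rw [Submodule.disjoint_def]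
  rintro _ ⟨c, rfl⟩ ⟨y, hy, hcy⟩
  by_contra hc
  have hc' : c ≠ 0 := fun h ↦ hc (by simp [h])
  have h1 : P.valuation (algebraMap K F c) = 1 := by
    rw [P.valuation_eq_zpow_ord ((map_ne_zero _).2 hc'), ord_algebraMap_holds P hc', zpow_zero]
  have h2 : P.valuation (algebraMap K F c) < 1 := by
    change P.uniformizer * y = algebraMap K F c at hcy
    rw [← hcy, Valuation.map_mul]
    calc P.valuation (P.uniformizer : F) * P.valuation y
        ≤ P.valuation (P.uniformizer : F) * 1 :=
          mul_le_mul_right ((P.toValuationSubring.valuation_le_one_iff y).2 ((P.mem_ball_zero_iff y).1 hy)) _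
      _ < 1 := by rw [mul_one]; exact P.valuation_uniformizer_lt_one
  exact h2.ne h1

/-- At a rational place the residue field is `K`: `K → F_P` is onto. [cite: Stichtenoth2009, Def. 1.1.14] -/
theorem IsRational.algebraMap_residueField_surjective {P : PlaceOver K F} (hP : P.IsRational) :
    Function.Surjective (algebraMap K P.residueField) := by
  haveI : FiniteDimensional K P.residueField := PlaceOver.finiteDimensional_residueField_holds P
  have hr : LinearMap.range (Algebra.linearMap K P.residueField) = ⊤ := by
    apply Submodule.eq_top_of_finrank_eq
    rw [LinearMap.finrank_range_of_inj (FaithfulSMul.algebraMap_injective K P.residueField),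
      Module.finrank_self]
    exact hP.symm
  intro r
  have : r ∈ LinearMap.range (Algebra.linearMap K P.residueField) := by rw [hr]; trivial
  obtain ⟨c, hc⟩ := this
  exact ⟨c, hc⟩

/-- At a rational place every `y ∈ 𝒪_P` is a constant plus an element of `π 𝒪_P`:
`𝒪_P = K ⊕ π𝒪_P`. [cite: Stichtenoth2009, Def. 1.1.14] -/
theorem IsRational.exists_sub_algebraMap_mem {P : PlaceOver K F} (hP : P.IsRational) {y : F}
    (hy : y ∈ P.toValuationSubring) : ∃ c : K, y - algebraMap K F c ∈ P.ball 1 := by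
  obtain ⟨c, hc⟩ := hP.algebraMap_residueField_surjective (IsLocalRing.residue _ ⟨y, hy⟩)
  refine ⟨c, ?_⟩
  have hmem : (⟨y, hy⟩ : P.toValuationSubring) - algebraMap K P.toValuationSubring c ∈
      IsLocalRing.maximalIdeal P.toValuationSubring := by
    rw [← IsLocalRing.residue_eq_zero_iff, map_sub, ← PlaceOver.algebraMap_residueField_apply, hc, sub_self]
  rw [mem_ball_iff, zpow_one, ← P.valuation_lt_one_iff_le]
  exact (P.toValuationSubring.valuation_lt_one_iff _).1 hmem

/-- At a rational place: `K + π𝒪_P = 𝒪_P`. [cite: Stichtenoth2009, Def. 1.1.14] -/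
theorem IsRational.constSubmodule_sup_map_uniformizer {P : PlaceOver K F} (hP : P.IsRational) :
    constSubmodule K ⊔ (P.intSubmodule K).map (LinearMap.mulLeft K (P.uniformizer : F)) = P.intSubmodule K := by
  refine le_antisymm (sup_le P.constSubmodule_le_intSubmodule
    (P.map_mulLeft_intSubmodule_le P.uniformizer.2)) fun y hy ↦ ?_
  obtain ⟨c, hc⟩ := hP.exists_sub_algebraMap_mem ((P.mem_ball_zero_iff y).1 hy)
  rw [show y = algebraMap K F c + (y - algebraMap K F c) by abel]
  refine Submodule.add_mem_sup ⟨c, rfl⟩ ⟨(y - algebraMap K F c) * (P.uniformizer : F) ^ (-(1 : ℤ)),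
    (P.mem_ball_zero_iff _).2 (P.mul_uniformizer_zpow_neg_mem 1 hc), ?_⟩
  rw [LinearMap.mulLeft_apply, zpow_neg, zpow_one, mul_comm, mul_assoc,
    inv_mul_cancel₀ P.coe_uniformizer_ne_zero, mul_one]

/-- **(R4)** at a rational place: `res_P(π⁻¹ dπ) = dim_K 𝒪_P/π𝒪_P = dim_K F_P = 1` (Tate 1968, §2,
(R4) and §3, Thm. 2: "`res_Y(t⁻¹ dt) = dim_k k(p) = 1`"). [cite: Tate1968, §3, Thm. 2] -/
theorem IsRational.localRes_inv_uniformizer {P : PlaceOver K F} (hP : P.IsRational) :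
    P.localRes K (P.uniformizer : F)⁻¹ (P.uniformizer : F) = 1 := by
  haveI : FiniteDimensional K (constSubmodule K (F := F)) :=
    Module.finite_of_finrank_eq_succ finrank_constSubmodule
  rw [localRes, res_inv_eq_finrank (g' := LinearMap.mulLeft K (P.uniformizer : F)⁻¹)
    (by rw [← mulLeft_mul', inv_mul_cancel₀ P.coe_uniformizer_ne_zero, LinearMap.mulLeft_one]; rfl)
    (P.map_mulLeft_intSubmodule_le P.uniformizer.2) P.constSubmodule_le_intSubmodule
    P.disjoint_constSubmodule_map_uniformizer hP.constSubmodule_sup_map_uniformizer,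
    finrank_constSubmodule, Nat.cast_one]

/-- **Local residues of powers of a local parameter** at a rational place:
`res_P(πⁿ dπ) = 1` if `n = -1` and `0` otherwise (Tate 1968, §3, Thm. 2). [cite: Tate1968, §3, Thm. 2] -/
theorem IsRational.localRes_uniformizer_zpow {P : PlaceOver K F} (hP : P.IsRational) (n : ℤ) :
    P.localRes K ((P.uniformizer : F) ^ n) (P.uniformizer : F) = if n = -1 then 1 else 0 := by
  split_ifs with h
  · rw [h, zpow_neg, zpow_one]; exact hP.localRes_inv_uniformizer
  · exact P.localRes_zpow_self P.coe_uniformizer_ne_zero h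

end localRes

end PlaceOver

/-! ### Locality: `res_{𝒜(0)}(x dy) = Σ_P res_P(x dy)` (Tate 1968, §3, Thm. 3) -/

section locality

variable [IsAlgFunctionField K F]

namespace Adele

/-- The adeles supported in a set `S` of places: `α_P = 0` for `P ∉ S` (Tate's `V_S`, viewed inside
`𝒜 = V_X` by extension by zero). [cite: Tate1968, §3, Thm. 3 (proof)] -/
def supportedIn (S : Set (PlaceOver K F)) : Submodule K (Adele K F) where
  carrier := {α | ∀ P ∉ S, α P = 0}
  zero_mem' := fun P _ ↦ Adele.zero_apply P
  add_mem' {α β} hα hβ P hP := by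
    simp only [Set.mem_setOf_eq] at hα hβ
    rw [Adele.add_apply, hα P hP, hβ P hP, add_zero]
  smul_mem' c α hα P hP := by
    simp only [Set.mem_setOf_eq] at hα
    rw [Adele.constSMul_apply, hα P hP, mul_zero]

/-- Membership in `supportedIn S`. [cite: Tate1968, §3, Thm. 3 (proof)] -/
theorem mem_supportedIn_iff (S : Set (PlaceOver K F)) (α : Adele K F) :
    α ∈ supportedIn S ↔ ∀ P ∉ S, α P = 0 :=
  Iff.rfl

/-- `supportedIn` is monotone. [folklore] -/
theorem supportedIn_mono {S T : Set (PlaceOver K F)} (h : S ⊆ T) : supportedIn S ≤ supportedIn T :=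
  fun _ hα P hP ↦ hα P fun hS ↦ hP (h hS)

/-- Every adele is supported in the set of all places. [folklore] -/
@[simp]
theorem supportedIn_univ : supportedIn (Set.univ : Set (PlaceOver K F)) = ⊤ :=
  eq_top_iff.2 fun _ _ P hP ↦ (hP (Set.mem_univ P)).elim

/-- Only `0` is supported in `∅`. [folklore] -/
@[simp]
theorem supportedIn_empty : supportedIn (∅ : Set (PlaceOver K F)) = ⊥ :=
  eq_bot_iff.2 fun _ hα ↦ (Submodule.mem_bot K).2 (Adele.ext fun P ↦ hα P (Set.notMem_empty P))

/-- Truncation of an adele to a set `S` of places (extension by zero off `S`): the projection of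
`𝒜 = V_S × V_{Sᶜ}` onto the first factor. [cite: Tate1968, §3, Thm. 3 (proof)] -/
def restrictTo (S : Set (PlaceOver K F)) : Adele K F →ₗ[K] Adele K F where
  toFun α := Adele.mk (fun P ↦ if P ∈ S then α P else 0) (α.finite_setOf_not_mem.subset fun P hP ↦ by
    simp only [Set.mem_setOf_eq] at hP ⊢
    by_contra h
    by_cases hS : P ∈ S
    · rw [if_pos hS] at hP; exact hP h
    · rw [if_neg hS] at hP; exact hP (zero_mem _))
  map_add' α β := by
    ext P
    simp only [Adele.mk_apply, Adele.add_apply]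
    split_ifs <;> simp
  map_smul' c α := by
    ext P
    simp only [Adele.mk_apply, Adele.constSMul_apply, RingHom.id_apply]
    split_ifs <;> simp

/-- Components of a truncated adele. [folklore] -/
@[simp]
theorem restrictTo_apply (S : Set (PlaceOver K F)) (α : Adele K F) (P : PlaceOver K F) :
    restrictTo S α P = if P ∈ S then α P else 0 := by
  simp [restrictTo, Adele.mk_apply]

/-- A truncated adele is supported in `S`. [folklore] -/
theorem restrictTo_mem_supportedIn (S : Set (PlaceOver K F)) (α : Adele K F) :
    restrictTo S α ∈ supportedIn S := fun P hP ↦ by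
  rw [restrictTo_apply, if_neg hP]

/-- Truncation fixes the adeles supported in `S`. [folklore] -/
theorem restrictTo_of_mem {S : Set (PlaceOver K F)} {α : Adele K F} (hα : α ∈ supportedIn S) :
    restrictTo S α = α := by
  ext P
  rw [restrictTo_apply]
  split_ifs with hP
  · rfl
  · exact (hα P hP).symm

/-- `α = α|_S + α|_{Sᶜ}`. [folklore] -/
theorem restrictTo_add_restrictTo_compl (S : Set (PlaceOver K F)) (α : Adele K F) :
    restrictTo S α + restrictTo Sᶜ α = α := by
  ext P
  simp only [Adele.add_apply, restrictTo_apply, Set.mem_compl_iff]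
  split_ifs <;> simp

/-- `𝒜 = V_S ⊕ V_{Sᶜ}` (Tate 1968, §3, proof of Thm. 3: "`V_S = V_T × ∏_{p ∈ S'} K_p`").
[cite: Tate1968, §3, Thm. 3 (proof)] -/
theorem isCompl_supportedIn_compl (S : Set (PlaceOver K F)) :
    IsCompl (supportedIn S) (supportedIn Sᶜ) := by
  constructor
  · rw [Submodule.disjoint_def]
    intro α h₁ h₂
    refine Adele.ext fun P ↦ ?_
    by_cases hP : P ∈ S
    · exact (h₂ P (fun h ↦ h hP)).trans (Adele.zero_apply P).symm
    · exact (h₁ P hP).trans (Adele.zero_apply P).symm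
  · rw [codisjoint_iff, eq_top_iff]
    intro α _
    rw [← restrictTo_add_restrictTo_compl S α]
    exact Submodule.add_mem_sup (restrictTo_mem_supportedIn S α) (restrictTo_mem_supportedIn Sᶜ α)

/-- Truncation commutes with multiplication by `x ∈ F`. [folklore] -/
theorem mulLeft_restrictTo (x : F) (S : Set (PlaceOver K F)) (α : Adele K F) :
    Adele.mulLeft x (restrictTo S α) = restrictTo S (Adele.mulLeft x α) := by
  ext P
  simp only [Adele.mulLeft_apply, Adele.smul_apply, restrictTo_apply]
  split_ifs <;> simp

/-- `V_S` is stable under multiplication by `x ∈ F`. [cite: Tate1968, §3, Thm. 3 (proof)] -/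
theorem mulLeft_mem_supportedIn (x : F) {S : Set (PlaceOver K F)} :
    ∀ α ∈ supportedIn S, Adele.mulLeft x α ∈ supportedIn S := fun α hα P hP ↦ by
  rw [Adele.mulLeft_apply, Adele.smul_apply, hα P hP, mul_zero]

/-- Truncation preserves `𝒜(D)`. [folklore] -/
theorem restrictTo_mem_adeleSubspace (S : Set (PlaceOver K F)) {D : Divisor K F} {α : Adele K F}
    (hα : α ∈ adeleSubspace D) : restrictTo S α ∈ adeleSubspace D := fun P ↦ by
  rw [restrictTo_apply]
  split_ifs
  · exact hα P
  · simp

/-- `𝒜(D)|_S = 𝒜(D) ∩ V_S`. [folklore] -/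
theorem map_restrictTo_adeleSubspace (S : Set (PlaceOver K F)) (D : Divisor K F) :
    (adeleSubspace D).map (restrictTo S) = adeleSubspace D ⊓ supportedIn S := by
  refine le_antisymm ?_ fun α ⟨hα, hαS⟩ ↦ ⟨α, hα, restrictTo_of_mem hαS⟩
  rintro _ ⟨α, hα, rfl⟩
  exact ⟨restrictTo_mem_adeleSubspace S hα, restrictTo_mem_supportedIn S α⟩

end Adele

open Adele

/-- `≼ 𝒜(D)` passes to `V_S`-parts: if `T ≼ 𝒜(D)` then `T ∩ V_S ≼ 𝒜(D) ∩ V_S` (truncate the witness).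
[folklore] -/
theorem NearlyLE.inf_supportedIn {T : Submodule K (Adele K F)} {D : Divisor K F}
    (h : NearlyLE T (adeleSubspace D)) (S : Set (PlaceOver K F)) :
    NearlyLE (T ⊓ supportedIn S) (adeleSubspace D ⊓ supportedIn S) := by
  obtain ⟨W, _, hW⟩ := h
  refine ⟨W.map (restrictTo S), inferInstance, fun α ⟨hαT, hαS⟩ ↦ ?_⟩
  obtain ⟨β, hβ, w, hw, hsum⟩ := Submodule.mem_sup.1 (hW hαT)
  rw [← restrictTo_of_mem hαS, ← hsum, map_add]
  exact Submodule.add_mem_sup ⟨restrictTo_mem_adeleSubspace S hβ, restrictTo_mem_supportedIn S _⟩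
    ⟨w, hw, rfl⟩

/-- Multiplication by `x ∈ F` lies in `E(𝒜(D) ∩ V_S)` (Tate 1968, §3: `f A_S ≺ A_S`).
[cite: Tate1968, §3, Thm. 3 (proof)] -/
theorem inE_adeleSubspace_inf_supportedIn (D : Divisor K F) (S : Set (PlaceOver K F)) (x : F) :
    InE (adeleSubspace D ⊓ supportedIn S) (Adele.mulLeft x) := by
  have h := NearlyLE.inf_supportedIn (inE_adeleSubspace_mulLeft D x) S
  refine h.mono_left ?_
  rintro _ ⟨α, ⟨hα, hαS⟩, rfl⟩
  exact ⟨⟨α, hα, rfl⟩, mulLeft_mem_supportedIn x α hαS⟩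

/-- The residue over the trivial subspace vanishes. [folklore] -/
theorem res_bot_mulLeft (x y : F) : res (⊥ : Submodule K (Adele K F)) (Adele.mulLeft x) (Adele.mulLeft y) = 0 := by
  have hp : LinearMap.IsProj (⊥ : Submodule K (Adele K F)) (0 : Module.End K (Adele K F)) :=
    ⟨fun _ ↦ Submodule.zero_mem _, fun x hx ↦ by rw [(Submodule.mem_bot K).1 hx, LinearMap.zero_apply]⟩
  have hE : ∀ z : F, InE (⊥ : Submodule K (Adele K F)) (Adele.mulLeft z) := fun z ↦
    inE_of_map_le (by rw [Submodule.map_bot])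
  rw [res_eq_fpTrace_of_isProj hp (hE x) (hE y) (commute_mulLeft x y)]
  simp

/-- **Additivity of the adelic residue over disjoint sets of places**:
`res_{𝒜(0) ∩ V_{S ∪ T}} = res_{𝒜(0) ∩ V_S} + res_{𝒜(0) ∩ V_T}` for disjoint `S, T` (Tate 1968, §3, proof
of Thm. 3: (R5)/(R1) for `V_S = V_T × ∏ K_p`, `A_S = A_T × ∏ A_p`). [cite: Tate1968, §3, Thm. 3 (proof)] -/
theorem res_inf_supportedIn_union {S T : Set (PlaceOver K F)} (hST : Disjoint S T) (x y : F) :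
    res (adeleSubspace 0 ⊓ supportedIn (S ∪ T)) (Adele.mulLeft x) (Adele.mulLeft y) =
      res (adeleSubspace 0 ⊓ supportedIn S) (Adele.mulLeft x) (Adele.mulLeft y) +
        res (adeleSubspace 0 ⊓ supportedIn T) (Adele.mulLeft x) (Adele.mulLeft y) := by
  have hc := isCompl_supportedIn_compl (K := K) (F := F) S
  have hTS : T ⊆ Sᶜ := fun P hP hPS ↦ Set.disjoint_left.1 hST hPS hP
  set A₁ := adeleSubspace (0 : Divisor K F) ⊓ supportedIn S with hA₁
  set A₂ := adeleSubspace (0 : Divisor K F) ⊓ supportedIn T with hA₂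
  have hA₁V : A₁ ≤ supportedIn S := inf_le_right
  have hA₂V : A₂ ≤ supportedIn Sᶜ := inf_le_right.trans (supportedIn_mono hTS)
  have hsup : A₁ ⊔ A₂ = adeleSubspace 0 ⊓ supportedIn (S ∪ T) := by
    refine le_antisymm (sup_le (inf_le_inf_left _ (supportedIn_mono Set.subset_union_left))
      (inf_le_inf_left _ (supportedIn_mono Set.subset_union_right))) fun α ⟨hα, hαST⟩ ↦ ?_
    rw [← restrictTo_add_restrictTo_compl S α]
    refine Submodule.add_mem_sup ⟨restrictTo_mem_adeleSubspace S hα, restrictTo_mem_supportedIn S α⟩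
      ⟨restrictTo_mem_adeleSubspace Sᶜ hα, fun P hP ↦ ?_⟩
    rw [restrictTo_apply]
    split_ifs with hPS
    · exact hαST P (fun h ↦ h.elim hPS hP)
    · rfl
  rw [← hsup, res_eq_add_of_isCompl hc hA₁V hA₂V (mulLeft_mem_supportedIn x) (mulLeft_mem_supportedIn x)
      (mulLeft_mem_supportedIn y) (mulLeft_mem_supportedIn y)
      (by rw [hsup]; exact inE_adeleSubspace_inf_supportedIn 0 _ x)
      (by rw [hsup]; exact inE_adeleSubspace_inf_supportedIn 0 _ y) (commute_mulLeft x y)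
      ((inE_adeleSubspace_inf_supportedIn 0 S x).restrict hA₁V _)
      ((inE_adeleSubspace_inf_supportedIn 0 S y).restrict hA₁V _)
      ((inE_adeleSubspace_inf_supportedIn 0 T x).restrict hA₂V _)
      ((inE_adeleSubspace_inf_supportedIn 0 T y).restrict hA₂V _),
    ← res_eq_res_restrict hA₁V _ _ (inE_adeleSubspace_inf_supportedIn 0 S x)
      (inE_adeleSubspace_inf_supportedIn 0 S y) (commute_mulLeft x y),
    ← res_eq_res_restrict hA₂V _ _ (inE_adeleSubspace_inf_supportedIn 0 T x)
      (inE_adeleSubspace_inf_supportedIn 0 T y) (commute_mulLeft x y)]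

/-- The `P`-component `V_{{P}} ≅ F`: an adele supported at `P` is its `P`-component (inverse:
`Adele.single P`). [cite: Tate1968, §3, Thm. 3 (proof)] -/
def supportedInSingletonEquiv (P : PlaceOver K F) : supportedIn ({P} : Set (PlaceOver K F)) ≃ₗ[K] F where
  toFun α := (α : Adele K F) P
  invFun z := ⟨Adele.single P z, fun Q hQ ↦ Adele.single_apply_of_ne hQ z⟩
  map_add' α β := Adele.add_apply _ _ P
  map_smul' c α := by
    rw [RingHom.id_apply, Submodule.coe_smul, Adele.constSMul_apply, Algebra.smul_def]
  left_inv α := by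
    apply Subtype.ext
    refine Adele.ext fun Q ↦ ?_
    by_cases hQ : Q = P
    · subst hQ; exact Adele.single_apply_self _ _
    · rw [Adele.single_apply_of_ne hQ]; exact (α.2 Q hQ).symm
  right_inv z := Adele.single_apply_self P z

/-- **The adelic residue on the `P`-component is the local residue at `P`**:
`res_{𝒜(0) ∩ V_{{P}}}(x dy) = res_P(x dy)` (Tate 1968, §3: `res^{V_S}_{A_S}` on the factor `K_p ⊇ A_p`,
transported along `V_{{P}} ≅ F`, `𝒜(0) ∩ V_{{P}} ≅ 𝒪_P` by (R1)). [cite: Tate1968, §3, Thm. 3 (proof)] -/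
theorem res_inf_supportedIn_singleton (P : PlaceOver K F) (x y : F) :
    res (adeleSubspace 0 ⊓ supportedIn {P}) (Adele.mulLeft x) (Adele.mulLeft y) = P.localRes K x y := by
  set V₀ := supportedIn ({P} : Set (PlaceOver K F))
  set A := adeleSubspace (0 : Divisor K F) ⊓ V₀
  have hAV : A ≤ V₀ := inf_le_right
  set e := supportedInSingletonEquiv (K := K) (F := F) P
  rw [res_eq_res_restrict hAV (mulLeft_mem_supportedIn x) (mulLeft_mem_supportedIn y)
    (inE_adeleSubspace_inf_supportedIn 0 _ x) (inE_adeleSubspace_inf_supportedIn 0 _ y) (commute_mulLeft x y),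
    ← res_conj e ((inE_adeleSubspace_inf_supportedIn 0 _ x).restrict hAV _)
      ((inE_adeleSubspace_inf_supportedIn 0 _ y).restrict hAV _)
      (LinearMap.restrict_commute (commute_mulLeft x y) _ _), PlaceOver.localRes]
  have hmul : ∀ z : F, e.conj ((Adele.mulLeft z).restrict (mulLeft_mem_supportedIn z)) = LinearMap.mulLeft K z := by
    intro z
    ext w
    rw [LinearEquiv.conj_apply_apply, LinearMap.mulLeft_apply]
    change (z • Adele.single P w : Adele K F) P = z * w
    rw [Adele.smul_apply, Adele.single_apply_self]
  have hA : (A.comap V₀.subtype).map (e : V₀ →ₗ[K] F) = P.intSubmodule K := by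
    ext z
    simp only [Submodule.mem_map, Submodule.mem_comap, Submodule.coe_subtype, LinearEquiv.coe_coe]
    constructor
    · rintro ⟨α, ⟨hα, -⟩, rfl⟩
      have := hα P
      rw [Finsupp.coe_zero, Pi.zero_apply, neg_zero, zpow_zero] at this
      exact (P.mem_ball_zero_iff _).2 ((P.toValuationSubring.valuation_le_one_iff _).1 this)
    · intro hz
      refine ⟨e.symm z, ⟨?_, (e.symm z).2⟩, e.apply_symm_apply z⟩
      change Adele.single P z ∈ adeleSubspace (0 : Divisor K F)
      rw [single_mem_adeleSubspace_iff, Finsupp.coe_zero, Pi.zero_apply, neg_zero, zpow_zero]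
      exact (P.toValuationSubring.valuation_le_one_iff z).2 ((P.mem_ball_zero_iff z).1 hz)
  rw [hmul, hmul, hA]

/-- `res_{𝒜(0) ∩ V_S}(x dy) = Σ_{P ∈ S} res_P(x dy)` for a finite set `S` of places.
[cite: Tate1968, §3, Thm. 3] -/
theorem res_inf_supportedIn_finset (S : Finset (PlaceOver K F)) (x y : F) :
    res (adeleSubspace 0 ⊓ supportedIn (↑S : Set (PlaceOver K F))) (Adele.mulLeft x) (Adele.mulLeft y) =
      ∑ P ∈ S, P.localRes K x y := by
  induction S using Finset.induction_on with
  | empty => rw [Finset.coe_empty, supportedIn_empty, inf_bot_eq, Finset.sum_empty]; exact res_bot_mulLeft x y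
  | insert P S hP ih =>
    rw [Finset.coe_insert, Set.insert_eq,
      res_inf_supportedIn_union (Set.disjoint_singleton_left.2 (by exact_mod_cast hP)) x y,
      res_inf_supportedIn_singleton, ih, Finset.sum_insert hP]

/-- Membership in `𝒜(0)`: all components integral. [cite: Stichtenoth2009, Def. 1.5.3] -/
theorem mem_adeleSubspace_zero_iff (α : Adele K F) :
    α ∈ adeleSubspace (0 : Divisor K F) ↔ ∀ P : PlaceOver K F, α P ∈ P.toValuationSubring := by
  refine forall_congr' fun P ↦ ?_
  rw [Finsupp.coe_zero, Pi.zero_apply, neg_zero, zpow_zero]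
  exact P.toValuationSubring.valuation_le_one_iff _

/-- **Thm. 3 of Tate 1968 (locality)**: if `S` is a finite set of places outside of which `x` and `y`
are integral, then `res_{𝒜(0)}(x dy) = Σ_{P ∈ S} res_P(x dy)` ("`Σ_{p ∈ S} res_p(ω) = res^{V_S}_{A_S}(ω)`,
almost all terms of the sum being zero"). [cite: Tate1968, §3, Thm. 3] -/
theorem adelicRes_eq_sum {x y : F} (S : Finset (PlaceOver K F))
    (hS : ∀ P ∉ S, x ∈ P.toValuationSubring ∧ y ∈ P.toValuationSubring) :
    adelicRes K x y = ∑ P ∈ S, P.localRes K x y := by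
  have hsplit := res_inf_supportedIn_union (S := (↑S : Set (PlaceOver K F))) (T := (↑S : Set (PlaceOver K F))ᶜ)
    disjoint_compl_right x y
  rw [Set.union_compl_self, supportedIn_univ, inf_top_eq, res_inf_supportedIn_finset] at hsplit
  rw [adelicRes, hsplit, add_eq_left]
  -- off S, x and y preserve 𝒜(0) ∩ V_{Sᶜ}
  have hinv : ∀ z : F, (∀ P ∉ S, z ∈ P.toValuationSubring) →
      (adeleSubspace (0 : Divisor K F) ⊓ supportedIn (↑S : Set (PlaceOver K F))ᶜ).map (Adele.mulLeft z) ≤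
        adeleSubspace (0 : Divisor K F) ⊓ supportedIn (↑S : Set (PlaceOver K F))ᶜ := by
    rintro z hz _ ⟨α, ⟨hα, hαS⟩, rfl⟩
    refine ⟨(mem_adeleSubspace_zero_iff _).2 fun P ↦ ?_, mulLeft_mem_supportedIn z α hαS⟩
    rw [Adele.mulLeft_apply, Adele.smul_apply]
    by_cases hPS : P ∈ S
    · rw [hαS P (fun h ↦ h hPS), mul_zero]; exact zero_mem _
    · exact mul_mem (hz P hPS) ((mem_adeleSubspace_zero_iff α).1 hα P)
  exact res_eq_zero_of_invariant (commute_mulLeft x y) (hinv x fun P hP ↦ (hS P hP).1)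
    (hinv y fun P hP ↦ (hS P hP).2)

/-- The finite set of places where `x` or `y` has a pole. [folklore] -/
theorem finite_setOf_not_mem₂ (x y : F) :
    {P : PlaceOver K F | ¬ (x ∈ P.toValuationSubring ∧ y ∈ P.toValuationSubring)}.Finite :=
  ((algebraMap F (Adele K F) x).finite_setOf_not_mem.union (algebraMap F (Adele K F) y).finite_setOf_not_mem).subset
    fun P hP ↦ by
      simp only [Set.mem_setOf_eq, not_and_or, Set.mem_union, Adele.algebraMap_apply] at hP ⊢
      exact hP

/-- **The residue theorem** (classical form; Tate 1968, §3, Corollary of Thm. 3): for `x, y ∈ F` and any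
finite set `S` of places outside of which `x` and `y` are integral, `Σ_{P ∈ S} res_P(x dy) = 0` — "the
sum of the residues of the differential `x dy` over all places is zero". Requires `K` to be the full
constant field of `F`. [cite: Tate1968, §3, Thm. 3, Corollary] -/
theorem sum_localRes_eq_zero [IsIntegrallyClosedIn K F] {x y : F} (S : Finset (PlaceOver K F))
    (hS : ∀ P ∉ S, x ∈ P.toValuationSubring ∧ y ∈ P.toValuationSubring) :
    ∑ P ∈ S, P.localRes K x y = 0 := by
  rw [← adelicRes_eq_sum S hS, adelicRes_eq_zero]

end locality


/-! ## Part II. The Weil differential `dy`, its divisor `(dy)`, and the Riemann–Hurwitz formula -/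


/-! ### `d(tⁿ) = n tⁿ⁻¹ dt` for local residues -/

namespace PlaceOver

section powers

variable [IsAlgFunctionField K F] (P : PlaceOver K F)

/-- `res_P(f d(gⁿ)) = n · res_P(f gⁿ⁻¹ dg)` for `n ≥ 1` (from the Leibniz rule). [cite: Tate1968, §3, Thm. 2 (proof)] -/
theorem localRes_pow_right (f g : F) (n : ℕ) :
    P.localRes K f (g ^ (n + 1)) = (n + 1 : K) * P.localRes K (f * g ^ n) g := by
  induction n generalizing f with
  | zero => simp
  | succ n ih =>
    rw [pow_succ, P.localRes_mul_right, ih (f * g), Nat.cast_succ]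
    ring_nf

/-- `res_P(f d(g⁻¹)) = -res_P(f g⁻² dg)` (`g ≠ 0`). [cite: Tate1968, §2, (R3) (proof)] -/
theorem localRes_inv_right (f : F) {g : F} (hg : g ≠ 0) :
    P.localRes K f g⁻¹ = -P.localRes K (f * g⁻¹ ^ 2) g := by
  have h := P.localRes_mul_right (f * g⁻¹) g g⁻¹
  rw [mul_inv_cancel₀ hg, localRes_one_right] at h
  have e1 : f * g⁻¹ * g = f := by rw [mul_assoc, inv_mul_cancel₀ hg, mul_one]
  rw [e1] at h
  rw [pow_two, ← mul_assoc]
  linear_combination -h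

/-- `res_P(f d(g⁻ᵏ⁻¹)) = -(k+1) · res_P(f g⁻ᵏ⁻² dg)` (`g ≠ 0`), by induction from the Leibniz rule.
[cite: Tate1968, §3, Thm. 2 (proof)] -/
theorem localRes_inv_pow_right (f : F) {g : F} (hg : g ≠ 0) (k : ℕ) :
    P.localRes K f (g⁻¹ ^ (k + 1)) = -(k + 1 : K) * P.localRes K (f * g⁻¹ ^ (k + 2)) g := by
  induction k generalizing f with
  | zero => rw [zero_add, pow_one, P.localRes_inv_right f hg]; simp
  | succ k ih =>
    rw [pow_succ, P.localRes_mul_right, P.localRes_inv_right _ hg, ih (f * g⁻¹)]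
    have e1 : f * g⁻¹ ^ (k + 1) * g⁻¹ ^ 2 = f * g⁻¹ ^ (k + 1 + 2) := by rw [mul_assoc, ← pow_add]
    have e2 : f * g⁻¹ * g⁻¹ ^ (k + 2) = f * g⁻¹ ^ (k + 1 + 2) := by
      rw [mul_assoc, ← pow_succ', show k + 2 + 1 = k + 1 + 2 by ring]
    rw [e1, e2]
    push_cast
    ring

/-- `res_P(f d(gⁿ)) = n · res_P(f gⁿ⁻¹ dg)` for all integers `n` (`g ≠ 0`).
[cite: Tate1968, §3, Thm. 2 (proof)] -/
theorem localRes_zpow_right (f : F) {g : F} (hg : g ≠ 0) (n : ℤ) :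
    P.localRes K f (g ^ n) = (n : K) * P.localRes K (f * g ^ (n - 1)) g := by
  rcases le_or_gt 0 n with h | h
  · obtain ⟨k, rfl⟩ := Int.eq_ofNat_of_zero_le h
    cases k with
    | zero => simp
    | succ k =>
      rw [zpow_natCast, P.localRes_pow_right, Nat.cast_succ, add_sub_cancel_right, zpow_natCast]
      push_cast; ring
  · obtain ⟨k, hk⟩ := Int.eq_ofNat_of_zero_le (by omega : 0 ≤ -n - 1)
    have hn : n = -((k : ℤ) + 1) := by omega
    subst hn
    have e1 : g ^ (-((k : ℤ) + 1)) = g⁻¹ ^ (k + 1) := by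
      rw [zpow_neg, ← inv_zpow, show ((k : ℤ) + 1) = ((k + 1 : ℕ) : ℤ) by push_cast; ring, zpow_natCast]
    have e2 : g ^ (-((k : ℤ) + 1) - 1) = g⁻¹ ^ (k + 2) := by
      rw [show (-((k : ℤ) + 1) - 1) = -((k + 2 : ℕ) : ℤ) by push_cast; ring, zpow_neg, ← inv_zpow,
        zpow_natCast]
    rw [e1, e2, P.localRes_inv_pow_right f hg k]
    push_cast
    ring

end powers

/-! ### The local expansion `y = c + tⁿ u` at a rational place, and the local theorem -/

section localThm

variable [IsAlgFunctionField K F] {P : PlaceOver K F}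

omit [IsAlgFunctionField K F] in
/-- A unit of `𝒪_P` has valuation one. [folklore] -/
theorem valuation_eq_one_iff (P : PlaceOver K F) (u : F) :
    P.valuation u = 1 ↔ u ∈ P.toValuationSubring ∧ u ∉ P.ball 1 := by
  rw [mem_ball_iff, zpow_one, ← P.valuation_lt_one_iff_le, not_lt, ← P.toValuationSubring.valuation_le_one_iff]
  change P.valuation u = 1 ↔ P.valuation u ≤ 1 ∧ 1 ≤ P.valuation u
  constructor
  · intro h; rw [h]; exact ⟨le_rfl, le_rfl⟩
  · rintro ⟨h1, h2⟩; exact le_antisymm h1 h2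

/-- **Local theorem, vanishing part** (Tate 1968, §3, Thm. 2: "only the term in `t⁻¹` can give
non-zero residue"): at a rational place `P` with local parameter `t`, if `y = c + tⁿ u` with `c ∈ K`,
`n ∈ ℤ` and `u ∈ 𝒪_P`, then `res_P(a dy) = 0` for every `a` with `v_P(a) ≥ 1 - n`.
[cite: Tate1968, §3, Thm. 2] -/
theorem localRes_eq_zero_of_expansion {y u : F} {c : K} {n : ℤ}
    (hy : y = algebraMap K F c + (P.uniformizer : F) ^ n * u) (hu : u ∈ P.toValuationSubring)
    {a : F} (ha : a ∈ P.ball (1 - n)) : P.localRes K a y = 0 := by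
  set t : F := (P.uniformizer : F) with ht
  have ht0 : t ≠ 0 := P.coe_uniformizer_ne_zero
  rw [hy, P.localRes_add_right, P.localRes_algebraMap_right, zero_add, P.localRes_mul_right,
    P.localRes_zpow_right _ ht0]
  -- res(a tⁿ du) = 0 : a tⁿ ∈ t𝒪 ⊆ 𝒪, u ∈ 𝒪
  have h1 : a * t ^ n ∈ P.toValuationSubring := by
    have := P.map_mulLeft_ball_le (zpow_ne_zero n ht0) (1 - n) ⟨a, ha, rfl⟩
    rw [ord_uniformizer_zpow, LinearMap.mulLeft_apply, mul_comm] at this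
    have h' : a * t ^ n ∈ P.ball 0 := P.ball_antitone (by omega) this
    exact (P.mem_ball_zero_iff _).1 h'
  -- res(a u t^{n-1} dt) = 0 : a u t^{n-1} ∈ 𝒪
  have h2 : a * u * t ^ (n - 1) ∈ P.toValuationSubring := by
    have hau : a * u ∈ P.ball (1 - n) := by
      have := P.map_mulLeft_intSubmodule_le hu
      by_cases hu0 : u = 0
      · rw [hu0, mul_zero]; exact zero_mem _
      · have := P.map_mulLeft_ball_le hu0 (1 - n) ⟨a, ha, rfl⟩
        rw [LinearMap.mulLeft_apply, mul_comm] at this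
        exact P.ball_antitone (by
          have := (P.mem_toValuationSubring_iff_ord_nonneg hu0).1 hu; omega) this
    have := P.map_mulLeft_ball_le (zpow_ne_zero (n - 1) ht0) (1 - n) ⟨a * u, hau, rfl⟩
    rw [ord_uniformizer_zpow, LinearMap.mulLeft_apply, mul_comm, show 1 - n + (n - 1) = 0 by ring] at this
    exact (P.mem_ball_zero_iff _).1 this
  rw [P.localRes_eq_zero_of_mem h1 hu, P.localRes_eq_zero_of_mem h2 P.uniformizer.2, mul_zero, add_zero]

/-- **Local theorem, leading term** (Tate 1968, §3, Thm. 2 with (R4)): at a rational place `P` with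
local parameter `t`, if `y = c + tⁿ u` with `c ∈ K`, `u ∈ 𝒪_P` and `u ≡ c_u (mod t)` (`c_u ∈ K` the
value of `u`), then `res_P(t⁻ⁿ dy) = n c_u` — the coefficient of `t⁻¹` in `t⁻ⁿ · d(c + tⁿu)/dt`.
[cite: Tate1968, §3, Thm. 2] -/
theorem localRes_zpow_neg_of_expansion (hP : P.IsRational) {y u : F} {c c_u : K} {n : ℤ}
    (hy : y = algebraMap K F c + (P.uniformizer : F) ^ n * u) (hu : u - algebraMap K F c_u ∈ P.ball 1) :
    P.localRes K ((P.uniformizer : F) ^ (-n)) y = n * c_u := by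
  set t : F := (P.uniformizer : F) with ht
  have ht0 : t ≠ 0 := P.coe_uniformizer_ne_zero
  have hu' : u ∈ P.toValuationSubring := by
    have h1 : u - algebraMap K F c_u ∈ P.toValuationSubring :=
      (P.mem_ball_zero_iff _).1 (P.ball_antitone (by norm_num) hu)
    simpa using add_mem h1 (P.algebraMap_mem c_u)
  rw [hy, P.localRes_add_right, P.localRes_algebraMap_right, zero_add, P.localRes_mul_right,
    ← zpow_add₀ ht0, neg_add_cancel, zpow_zero, P.localRes_zpow_right _ ht0]
  -- res(1 du) = 0
  rw [show (1 : F) = algebraMap K F 1 by simp, P.localRes_algebraMap_left, zero_add]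
  -- t^{-n} u t^{n-1} = u t⁻¹
  have e : t ^ (-n) * u * t ^ (n - 1) = u * t⁻¹ := by
    rw [mul_comm (t ^ (-n)) u, mul_assoc, ← zpow_add₀ ht0, show -n + (n - 1) = -1 by ring, zpow_neg_one]
  rw [e, show u * t⁻¹ = (u - algebraMap K F c_u) * t⁻¹ + c_u • t⁻¹ by rw [sub_mul, Algebra.smul_def]; ring,
    P.localRes_add_left, P.localRes_smul_left, hP.localRes_inv_uniformizer, mul_one]
  -- res((u - c_u) t⁻¹ dt) = 0
  have hmem : (u - algebraMap K F c_u) * t⁻¹ ∈ P.toValuationSubring := by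
    have := P.mul_uniformizer_zpow_neg_mem 1 hu
    rwa [zpow_neg, zpow_one] at this
  rw [P.localRes_eq_zero_of_mem hmem P.uniformizer.2, zero_add]

omit [IsAlgFunctionField K F] in
/-- The constant `c_u` of a unit is nonzero. [folklore] -/
theorem ne_zero_of_sub_algebraMap_mem {u : F} {c_u : K} (hu : P.valuation u = 1)
    (h : u - algebraMap K F c_u ∈ P.ball 1) : c_u ≠ 0 := by
  rintro rfl
  rw [map_zero, sub_zero] at h
  exact ((P.valuation_eq_one_iff u).1 hu).2 h

/-! #### The value `y(P) ∈ K` and the order of `dy` at `P` -/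

variable (P)

omit [IsAlgFunctionField K F] in
/-- Two constants congruent to `y` modulo `t𝒪_P` are equal. [folklore] -/
theorem eq_of_sub_algebraMap_mem {y : F} {c c' : K} (hc : y - algebraMap K F c ∈ P.ball 1)
    (hc' : y - algebraMap K F c' ∈ P.ball 1) : c = c' := by
  by_contra hne
  have hmem : algebraMap K F (c' - c) ∈ P.ball 1 := by
    have := sub_mem hc hc'
    rwa [sub_sub_sub_cancel_left, ← map_sub] at this
  have h1 : P.valuation (algebraMap K F (c' - c)) = 1 := by
    rw [P.valuation_eq_zpow_ord ((map_ne_zero _).2 (sub_ne_zero.2 (Ne.symm hne))),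
      ord_algebraMap_holds P (sub_ne_zero.2 (Ne.symm hne)), zpow_zero]
  exact ((P.valuation_eq_one_iff _).1 h1).2 hmem

/-- **The value `y(P) ∈ K`** of `y` at the place `P`: the constant `c` with `y ≡ c (mod t𝒪_P)` when there
is one (always, at a rational place, for `y ∈ 𝒪_P`: `IsRational.sub_value_mem`), junk `0` otherwise.
[cite: Stichtenoth2009, Def. 1.1.15] -/
def value (y : F) : K :=
  if h : ∃ c : K, y - algebraMap K F c ∈ P.ball 1 then h.choose else 0

omit [IsAlgFunctionField K F] in
/-- Characterisation of `value`. [cite: Stichtenoth2009, Def. 1.1.15] -/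
theorem value_eq_of_sub_algebraMap_mem {y : F} {c : K} (hc : y - algebraMap K F c ∈ P.ball 1) :
    P.value y = c := by
  have h : ∃ c : K, y - algebraMap K F c ∈ P.ball 1 := ⟨c, hc⟩
  rw [value, dif_pos h]
  exact P.eq_of_sub_algebraMap_mem h.choose_spec hc

/-- At a rational place, `y ≡ y(P) (mod t𝒪_P)` for `y ∈ 𝒪_P`. [cite: Stichtenoth2009, Def. 1.1.15] -/
theorem IsRational.sub_value_mem {P : PlaceOver K F} (hP : P.IsRational) {y : F} (hy : y ∈ P.toValuationSubring) :
    y - algebraMap K F (P.value y) ∈ P.ball 1 := by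
  obtain ⟨c, hc⟩ := hP.exists_sub_algebraMap_mem hy
  rwa [P.value_eq_of_sub_algebraMap_mem hc]

omit [IsAlgFunctionField K F] in
/-- The value of a constant is itself. [folklore] -/
@[simp]
theorem value_algebraMap (c : K) : P.value (algebraMap K F c) = c :=
  P.value_eq_of_sub_algebraMap_mem (by rw [sub_self]; exact zero_mem _)

/-- **The order `ν_P(dy)` of the differential `dy` at `P`** (characteristic `0`, rational place):
`v_P(y - y(P)) - 1` if `y` is integral at `P` (`= e_P - 1`, `e_P` the ramification index of `P` over
`K(y)`), and `v_P(y) - 1 = -e_P - 1` at a pole of order `e_P` (Dedekind's different theorem in the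
tame case, Stichtenoth Thm. 3.5.1 / Cor. 3.5.5 with Remark 4.3.7 (c): `(dy) = -2(y)_∞ + Diff(F/K(y))`).
[cite: Stichtenoth2009, Thm. 3.5.1, Remark 4.3.7] -/
def diffOrd (y : F) : ℤ :=
  if y ∈ P.toValuationSubring then P.ord (y - algebraMap K F (P.value y)) - 1 else P.ord y - 1

omit [IsAlgFunctionField K F] in
/-- At a pole, `diffOrd_P(y) = v_P(y) - 1`. [cite: Stichtenoth2009, Remark 4.3.7] -/
theorem diffOrd_of_not_mem {y : F} (hy : y ∉ P.toValuationSubring) : P.diffOrd y = P.ord y - 1 := by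
  rw [diffOrd, if_neg hy]

/-- At a finite place, `diffOrd_P(y) = v_P(y - c) - 1` for the (unique) constant `c` with `y ≡ c (mod t)`
(`= e_P - 1`). [cite: Stichtenoth2009, Thm. 3.5.1] -/
theorem diffOrd_of_sub_algebraMap_mem {y : F} {c : K} (hc : y - algebraMap K F c ∈ P.ball 1) :
    P.diffOrd y = P.ord (y - algebraMap K F c) - 1 := by
  have hy : y ∈ P.toValuationSubring := by
    have h1 : y - algebraMap K F c ∈ P.toValuationSubring :=
      (P.mem_ball_zero_iff _).1 (P.ball_antitone (by norm_num) hc)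
    simpa using add_mem h1 (P.algebraMap_mem c)
  rw [diffOrd, if_pos hy, P.value_eq_of_sub_algebraMap_mem hc]

variable {P}

/-- **Local expansion at a rational place**: for `y ∉ K` there are `c, c_u ∈ K`, a unit `u ∈ 𝒪_P^×` with
`u ≡ c_u (mod t)` such that `y = c + tⁿ u` where `n = diffOrd_P(y) + 1 ≠ 0`.
[cite: Stichtenoth2009, Thm. 1.1.6] -/
theorem IsRational.exists_expansion (hP : P.IsRational) {y : F} (hy : y ∉ Set.range (algebraMap K F)) :
    ∃ (c c_u : K) (u : F), P.diffOrd y + 1 ≠ 0 ∧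
      y = algebraMap K F c + (P.uniformizer : F) ^ (P.diffOrd y + 1) * u ∧
      P.valuation u = 1 ∧ u - algebraMap K F c_u ∈ P.ball 1 := by
  set t : F := (P.uniformizer : F) with ht
  have ht0 : t ≠ 0 := P.coe_uniformizer_ne_zero
  -- the generic construction from `z = y - c ≠ 0` with `n = ord z`
  have build : ∀ (c : K) (z : F), z ≠ 0 → y = algebraMap K F c + z →
      ∃ (c_u : K) (u : F), y = algebraMap K F c + t ^ (P.ord z) * u ∧ P.valuation u = 1 ∧
        u - algebraMap K F c_u ∈ P.ball 1 := by
    intro c z hz hyz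
    set u := z * t ^ (-(P.ord z)) with hu
    have hval : P.valuation u = 1 := by
      rw [hu, Valuation.map_mul, map_zpow₀, P.valuation_eq_zpow_ord hz, ← zpow_add₀ P.valuation_uniformizer_ne_zero,
        add_neg_cancel, zpow_zero]
    have hu' : u ∈ P.toValuationSubring := ((P.valuation_eq_one_iff u).1 hval).1
    obtain ⟨c_u, hcu⟩ := hP.exists_sub_algebraMap_mem hu'
    refine ⟨c_u, u, ?_, hval, hcu⟩
    rw [hyz, hu, mul_comm z, ← mul_assoc, ← zpow_add₀ ht0, add_neg_cancel, zpow_zero, one_mul]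
  by_cases hyO : y ∈ P.toValuationSubring
  · -- finite place: c = y(P), z = y - c, n = ord z ≥ 1
    set c := P.value y
    have hz : y - algebraMap K F c ∈ P.ball 1 := hP.sub_value_mem hyO
    have hz0 : y - algebraMap K F c ≠ 0 := fun h ↦ hy ⟨c, (sub_eq_zero.1 h).symm⟩
    have hn : P.diffOrd y + 1 = P.ord (y - algebraMap K F c) := by rw [diffOrd, if_pos hyO]; ring
    have hord : 1 ≤ P.ord (y - algebraMap K F c) := (P.mem_ball_iff_le_ord 1 hz0).1 hz
    obtain ⟨c_u, u, h1, h2, h3⟩ := build c _ hz0 (by abel)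
    exact ⟨c, c_u, u, by omega, hn ▸ h1, h2, h3⟩
  · -- pole: c = 0, z = y, n = ord y < 0
    have hy0 : y ≠ 0 := fun h ↦ hyO (h ▸ zero_mem _)
    have hn : P.diffOrd y + 1 = P.ord y := by rw [diffOrd, if_neg hyO]; ring
    have hord : P.ord y < 0 := by
      by_contra h
      exact hyO ((P.mem_toValuationSubring_iff_ord_nonneg hy0).2 (not_lt.1 h))
    obtain ⟨c_u, u, h1, h2, h3⟩ := build 0 y hy0 (by simp)
    exact ⟨0, c_u, u, by omega, hn ▸ h1, h2, h3⟩

end localThm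

end PlaceOver

/-! ### The Weil differential `dy` ("`ω_y`") attached to `y ∈ F` -/

section weil

variable [IsAlgFunctionField K F]

/-- The finite set of places where the adele `α` or the element `y` is not integral. [folklore] -/
def badFinset (α : Adele K F) (y : F) : Finset (PlaceOver K F) :=
  (α.finite_setOf_not_mem.union (algebraMap F (Adele K F) y).finite_setOf_not_mem).toFinset

/-- Off `badFinset α y`, both `α_P` and `y` are integral. [folklore] -/
theorem mem_of_not_mem_badFinset {α : Adele K F} {y : F} {P : PlaceOver K F} (hP : P ∉ badFinset α y) :
    α P ∈ P.toValuationSubring ∧ y ∈ P.toValuationSubring := by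
  simp only [badFinset, Set.Finite.mem_toFinset, Set.mem_union, Set.mem_setOf_eq, not_or, not_not,
    Adele.algebraMap_apply] at hP
  exact hP

/-- The function `α ↦ Σ_P res_P(α_P dy)` (a finite sum). [cite: Tate1968, §4, (co)] -/
def weilFun (y : F) (α : Adele K F) : K :=
  ∑ᶠ P : PlaceOver K F, P.localRes K (α P) y

/-- `Σ_P res_P(α_P dy)` as a finite sum over any finite set of places off which `α` and `y` are integral.
[cite: Tate1968, §3, Thm. 3] -/
theorem weilFun_eq_sum (y : F) (α : Adele K F) (S : Finset (PlaceOver K F))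
    (hS : ∀ P ∉ S, α P ∈ P.toValuationSubring ∧ y ∈ P.toValuationSubring) :
    weilFun y α = ∑ P ∈ S, P.localRes K (α P) y := by
  refine finsum_eq_finsetSum_of_support_subset _ fun P hP ↦ ?_
  by_contra h
  exact hP (P.localRes_eq_zero_of_mem (hS P h).1 (hS P h).2)

/-- `Σ_Q res_Q((single_P a)_Q dy) = res_P(a dy)`. [folklore] -/
theorem weilFun_single (y : F) (P : PlaceOver K F) (a : F) : weilFun y (Adele.single P a) = P.localRes K a y := by
  rw [weilFun, finsum_eq_finsetSum_of_support_subset _ (s := {P}), Finset.sum_singleton, Adele.single_apply_self]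
  intro Q hQ
  by_contra h
  rw [Finset.coe_singleton, Set.mem_singleton_iff] at h
  refine hQ ?_
  change PlaceOver.localRes K Q (Adele.single P a Q) y = 0
  rw [Adele.single_apply_of_ne h, PlaceOver.localRes_zero_left]

/-- **The Weil differential `dy` as a linear form on the adeles**: `ω_y(α) = Σ_P res_P(α_P dy)` (Tate 1968,
§4: the map `c(ω)(f) = Σ_p res_p(f_p ω)` from differentials to the dualizing sheaf `J = ` Weil
differentials). [cite: Tate1968, §4, Thm. 5] -/
def weilDifferentialOfFun (y : F) : Module.Dual K (Adele K F) where
  toFun := weilFun y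
  map_add' α β := by
    set S := badFinset α y ∪ badFinset β y
    have hα : ∀ P ∉ S, α P ∈ P.toValuationSubring ∧ y ∈ P.toValuationSubring := fun P hP ↦
      mem_of_not_mem_badFinset fun h ↦ hP (Finset.mem_union_left _ h)
    have hβ : ∀ P ∉ S, β P ∈ P.toValuationSubring ∧ y ∈ P.toValuationSubring := fun P hP ↦
      mem_of_not_mem_badFinset fun h ↦ hP (Finset.mem_union_right _ h)
    have hαβ : ∀ P ∉ S, (α + β) P ∈ P.toValuationSubring ∧ y ∈ P.toValuationSubring := fun P hP ↦
      ⟨by rw [Adele.add_apply]; exact add_mem (hα P hP).1 (hβ P hP).1, (hα P hP).2⟩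
    rw [weilFun_eq_sum y _ S hαβ, weilFun_eq_sum y _ S hα, weilFun_eq_sum y _ S hβ, ← Finset.sum_add_distrib]
    exact Finset.sum_congr rfl fun P _ ↦ by rw [Adele.add_apply, PlaceOver.localRes_add_left]
  map_smul' c α := by
    set S := badFinset α y
    have hα : ∀ P ∉ S, α P ∈ P.toValuationSubring ∧ y ∈ P.toValuationSubring := fun P hP ↦
      mem_of_not_mem_badFinset hP
    have hcα : ∀ P ∉ S, (c • α) P ∈ P.toValuationSubring ∧ y ∈ P.toValuationSubring := fun P hP ↦
      ⟨by rw [Adele.constSMul_apply]; exact mul_mem (P.algebraMap_mem c) (hα P hP).1, (hα P hP).2⟩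
    rw [RingHom.id_apply, weilFun_eq_sum y _ S hcα, weilFun_eq_sum y _ S hα, smul_eq_mul, Finset.mul_sum]
    exact Finset.sum_congr rfl fun P _ ↦ by
      rw [Adele.constSMul_apply, ← Algebra.smul_def, PlaceOver.localRes_smul_left]

/-- `ω_y(α) = Σ_P res_P(α_P dy)`. [cite: Tate1968, §4, Thm. 5] -/
theorem weilDifferentialOfFun_apply (y : F) (α : Adele K F) :
    weilDifferentialOfFun y α = ∑ᶠ P : PlaceOver K F, P.localRes K (α P) y :=
  rfl

/-- `ω_y(single_P a) = res_P(a dy)`: the local components of `ω_y` are the local residues.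
[cite: Tate1968, §4, Thm. 5] -/
theorem weilDifferentialOfFun_single (y : F) (P : PlaceOver K F) (a : F) :
    weilDifferentialOfFun y (Adele.single P a) = P.localRes K a y :=
  weilFun_single y P a

/-- `ω_y` kills the principal adeles: the residue theorem. [cite: Tate1968, §3, Thm. 3, Corollary] -/
theorem weilDifferentialOfFun_algebraMap [IsIntegrallyClosedIn K F] (y x : F) :
    weilDifferentialOfFun y (algebraMap F (Adele K F) x) = 0 := by
  set S := (finite_setOf_not_mem₂ (K := K) x y).toFinset
  have hS : ∀ P ∉ S, x ∈ P.toValuationSubring ∧ y ∈ P.toValuationSubring := fun P hP ↦ by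
    by_contra h; exact hP ((Set.Finite.mem_toFinset _).2 h)
  change weilFun y _ = 0
  rw [weilFun_eq_sum y _ S (fun P hP ↦ by rw [Adele.algebraMap_apply]; exact hS P hP)]
  simp only [Adele.algebraMap_apply]
  exact sum_localRes_eq_zero S hS

/-- `res_P(a dy) = 0` as soon as `v_P(a) ≥ 2 max(-v_P(y), 0)`. [cite: Tate1968, §2, (R2)] -/
theorem PlaceOver.localRes_eq_zero_of_mem_ball (P : PlaceOver K F) {a y : F}
    (ha : a ∈ P.ball (2 * max (-P.ord y) 0)) : P.localRes K a y = 0 := by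
  have hm : 0 ≤ 2 * max (-P.ord y) 0 := by positivity
  have haO : a ∈ P.toValuationSubring := (P.mem_ball_zero_iff a).1 (P.ball_antitone hm ha)
  by_cases hy : y = 0
  · rw [hy, PlaceOver.localRes_zero_right]
  by_cases ha0 : a = 0
  · rw [ha0, PlaceOver.localRes_zero_left]
  have horda : 2 * max (-P.ord y) 0 ≤ P.ord a := (P.mem_ball_iff_le_ord _ ha0).1 ha
  refine P.localRes_eq_zero_of_mem₃ haO ?_ ?_
  · rw [P.mem_toValuationSubring_iff_ord_nonneg (mul_ne_zero ha0 hy), P.ord_mul_eq ha0 hy]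
    have := le_max_left (-P.ord y) 0; have := le_max_right (-P.ord y) 0; omega
  · rw [P.mem_toValuationSubring_iff_ord_nonneg (mul_ne_zero (mul_ne_zero ha0 hy) hy),
      P.ord_mul_eq (mul_ne_zero ha0 hy) hy, P.ord_mul_eq ha0 hy]
    have := le_max_left (-P.ord y) 0; have := le_max_right (-P.ord y) 0; omega

/-- `d0 = 0`. [folklore] -/
theorem weilDifferentialOfFun_zero : weilDifferentialOfFun (0 : F) = (0 : Module.Dual K (Adele K F)) := by
  ext α
  change weilFun 0 α = 0
  rw [weilFun_eq_sum 0 α (badFinset α 0) fun P hP ↦ mem_of_not_mem_badFinset hP]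
  simp

/-- `ω_y` vanishes on `𝒜(-2(y)_∞)` (a crude bound; the exact divisor is `differentialDivisor_dOf`).
[cite: Tate1968, §4, (co)] -/
theorem weilDifferentialOfFun_mem [IsIntegrallyClosedIn K F] (y : F) :
    weilDifferentialOfFun y ∈
      weilDifferentialSpace (-((principalDivisor K y)⁻ + (principalDivisor K y)⁻)) := by
  by_cases hy : y = 0
  · subst hy; rw [weilDifferentialOfFun_zero]; exact zero_mem _
  rw [mem_weilDifferentialSpace_iff']
  refine ⟨fun α hα ↦ ?_, weilDifferentialOfFun_algebraMap y⟩
  change weilFun y α = 0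
  rw [weilFun_eq_sum y α (badFinset α y) fun P hP ↦ mem_of_not_mem_badFinset hP]
  refine Finset.sum_eq_zero fun P _ ↦ P.localRes_eq_zero_of_mem_ball ?_
  have h := hα P
  rw [PlaceOver.mem_ball_iff]
  convert h using 2
  simp only [Finsupp.coe_neg, Pi.neg_apply, neg_neg, Finsupp.coe_add, Pi.add_apply, Divisor.negPart_apply,
    principalDivisor_apply_of_ne_zero hy]
  ring

variable (K) in
/-- **The Weil differential `dy` of `y ∈ F`**: the linear form `α ↦ Σ_P res_P(α_P dy)` on the adeles, which
vanishes on `F` (residue theorem) and on some `𝒜(D)`, hence is a Weil differential (Tate 1968, §4,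
Thm. 5: `c : Ω¹_{K/k} → J_{K/k}` is an isomorphism; here only its construction on exact differentials
`dy`, which is all that is needed for divisors). [cite: Tate1968, §4, Thm. 5] -/
def dOf [IsIntegrallyClosedIn K F] (y : F) : weilDifferential K F :=
  ⟨weilDifferentialOfFun y, _, weilDifferentialOfFun_mem y⟩

/-- `dy(α) = Σ_P res_P(α_P dy)`. [cite: Tate1968, §4, Thm. 5] -/
theorem dOf_apply [IsIntegrallyClosedIn K F] (y : F) (α : Adele K F) :
    (dOf K y : Module.Dual K (Adele K F)) α = ∑ᶠ P : PlaceOver K F, P.localRes K (α P) y :=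
  rfl

/-- The local components of `dy` are the local residues: `dy(single_P a) = res_P(a dy)`.
[cite: Tate1968, §4, Thm. 5] -/
theorem dOf_single [IsIntegrallyClosedIn K F] (y : F) (P : PlaceOver K F) (a : F) :
    (dOf K y : Module.Dual K (Adele K F)) (Adele.single P a) = P.localRes K a y :=
  weilFun_single y P a

end weil

/-! ### The divisor of `dy`: `(dy)_P = diffOrd_P(y)` (characteristic `0`, all places rational) -/

section divisor

variable [IsAlgFunctionField K F] [IsIntegrallyClosedIn K F] [CharZero K]

/-- `dy ≠ 0` for `y ∉ K` (all places rational, characteristic `0`): `res_P(t⁻ⁿ dy) = n c_u ≠ 0`.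
[cite: Tate1968, §4, Thm. 5] -/
theorem dOf_ne_zero (hrat : ∀ P : PlaceOver K F, P.IsRational) {y : F} (hy : y ∉ Set.range (algebraMap K F)) :
    dOf K y ≠ 0 := by
  obtain ⟨P⟩ := nonempty_placeOver (K := K) (F := F)
  obtain ⟨c, c_u, u, hn, hyexp, hu, hcu⟩ := (hrat P).exists_expansion hy
  intro h
  have h1 : (dOf K y : Module.Dual K (Adele K F)) (Adele.single P ((P.uniformizer : F) ^ (-(P.diffOrd y + 1)))) = 0 := by
    rw [h]; rfl
  rw [dOf_single, PlaceOver.localRes_zpow_neg_of_expansion (hrat P) hyexp hcu] at h1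
  exact mul_ne_zero (Int.cast_ne_zero.2 hn) (PlaceOver.ne_zero_of_sub_algebraMap_mem hu hcu) h1

/-- **The divisor of `dy`.** Let `F/K` be an algebraic function field of characteristic `0` with full
constant field `K` all of whose places are rational (e.g. `K` algebraically closed), and `y ∈ F ∖ K`. Then
the divisor of the Weil differential `dy` is, at every place `P`,
`(dy)_P = v_P(y - y(P)) - 1` if `v_P(y) ≥ 0` and `(dy)_P = v_P(y) - 1` if `v_P(y) < 0`
— i.e. `(dy) = Σ_P (e_P - 1) P - Σ_{poles} (e_P + 1) P = -2(y)_∞ + Diff(F/K(y))` (Stichtenoth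
Cor. 3.4.7 with Dedekind's Thm. 3.5.1 in the tame case, Remark 4.3.7; here obtained from Tate's Thm. 2:
`res_P(a dy) = 0` for `v_P(a) ≥ 1 - n` and `res_P(t⁻ⁿ dy) = n u(P) ≠ 0`, `y = c + tⁿu`).
[cite: Stichtenoth2009, Cor. 3.4.7, Thm. 3.5.1] -/
theorem differentialDivisor_dOf_apply (hrat : ∀ P : PlaceOver K F, P.IsRational) {y : F}
    (hy : y ∉ Set.range (algebraMap K F)) (P : PlaceOver K F) :
    differentialDivisor (dOf K y) P = P.diffOrd y := by
  have hω := dOf_ne_zero hrat hy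
  set W := differentialDivisor (dOf K y) with hW
  obtain ⟨c, c_u, u, hn, hyexp, hu, hcu⟩ := (hrat P).exists_expansion hy
  set n := P.diffOrd y + 1 with hn_def
  have hres : P.localRes K ((P.uniformizer : F) ^ (-n)) y ≠ 0 := by
    rw [PlaceOver.localRes_zpow_neg_of_expansion (hrat P) hyexp hcu]
    exact mul_ne_zero (Int.cast_ne_zero.2 hn) (PlaceOver.ne_zero_of_sub_algebraMap_mem hu hcu)
  have hωW := ((mem_weilDifferentialSpace_iff' W _).1 (mem_weilDifferentialSpace_differentialDivisor hω)).1
  apply le_antisymm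
  · -- `W P ≤ n - 1`: otherwise `single_P t⁻ⁿ ∈ 𝒜(W)` is killed by `dy`
    by_contra hlt
    have hle : n ≤ W P := by omega
    have hmem : Adele.single P ((P.uniformizer : F) ^ (-n)) ∈ adeleSubspace W := by
      rw [single_mem_adeleSubspace_iff, map_zpow₀]
      exact P.zpow_valuation_uniformizer_le_of_le (neg_le_neg hle)
    have h0 := hωW _ hmem
    rw [dOf_single] at h0
    exact hres h0
  · -- `n - 1 ≤ W P`: `dy ∈ Ω(D)` for `D = W` changed to `n - 1` at `P`
    set D := W.update P (n - 1) with hD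
    suffices hmem : (dOf K y : Module.Dual K (Adele K F)) ∈ weilDifferentialSpace D by
      have := le_differentialDivisor_of_mem hω hmem P
      rw [hD, Finsupp.coe_update, Function.update_self, ← hW] at this
      omega
    rw [mem_weilDifferentialSpace_iff']
    refine ⟨fun α hα ↦ ?_, weilDifferentialOfFun_algebraMap y⟩
    have hsplit : α = (α - Adele.single P (α P)) + Adele.single P (α P) := by abel
    have hβ : α - Adele.single P (α P) ∈ adeleSubspace W := by
      intro Q
      by_cases hQ : Q = P
      · subst hQ
        rw [Adele.sub_apply, Adele.single_apply_self, sub_self, map_zero]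
        exact zero_le
      · rw [Adele.sub_apply, Adele.single_apply_of_ne hQ, sub_zero]
        have := hα Q
        rwa [hD, Finsupp.coe_update, Function.update_of_ne hQ] at this
    rw [hsplit, map_add, hωW _ hβ, zero_add, dOf_single]
    refine PlaceOver.localRes_eq_zero_of_expansion hyexp ((P.valuation_eq_one_iff u).1 hu).1 ?_
    have := hα P
    rw [hD, Finsupp.coe_update, Function.update_self] at this
    rw [PlaceOver.mem_ball_iff]
    convert this using 2
    ring

/-- The canonical divisor `(dy)` explicitly: `(dy)` is canonical, `deg (dy) = 2g - 2`, `ℓ((dy)) = g`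
(Stichtenoth Cor. 1.5.16, Prop. 1.6.? applied to `dy ≠ 0`). [cite: Stichtenoth2009, Cor. 1.5.16] -/
theorem isCanonical_differentialDivisor_dOf (hrat : ∀ P : PlaceOver K F, P.IsRational) {y : F}
    (hy : y ∉ Set.range (algebraMap K F)) :
    (differentialDivisor (dOf K y)).IsCanonical ∧
      (differentialDivisor (dOf K y)).degree = 2 * genus K F - 2 ∧
        ell (differentialDivisor (dOf K y)) = genus K F :=
  ⟨isCanonical_differentialDivisor (dOf_ne_zero hrat hy), degree_differentialDivisor (dOf_ne_zero hrat hy),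
    ell_differentialDivisor (dOf_ne_zero hrat hy)⟩

/-- Only finitely many places are ramified over `K(y)` or poles of `y`: `{P | diffOrd_P(y) ≠ 0}` is
finite (it is the support of the divisor `(dy)`). [cite: Stichtenoth2009, Cor. 3.5.5] -/
theorem finite_setOf_diffOrd_ne_zero (hrat : ∀ P : PlaceOver K F, P.IsRational) {y : F}
    (hy : y ∉ Set.range (algebraMap K F)) : {P : PlaceOver K F | P.diffOrd y ≠ 0}.Finite := by
  refine (differentialDivisor (dOf K y)).support.finite_toSet.subset fun P hP ↦ ?_
  rw [Set.mem_setOf_eq, ← differentialDivisor_dOf_apply hrat hy P] at hP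
  exact Finset.mem_coe.2 (Finsupp.mem_support_iff.2 hP)

omit [IsAlgFunctionField K F] [IsIntegrallyClosedIn K F] [CharZero K] in
/-- With all places rational, `deg D = Σ_P D(P)`. [cite: Stichtenoth2009, Def. 1.4.1] -/
theorem Divisor.degree_eq_finsum (hrat : ∀ P : PlaceOver K F, P.IsRational) (D : Divisor K F) :
    D.degree = ∑ᶠ P : PlaceOver K F, D P := by
  rw [finsum_eq_finsetSum_of_support_subset _ (s := D.support) (fun P hP ↦ by simpa using hP),
    Divisor.degree, Finsupp.liftAddHom_apply, Finsupp.sum]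
  refine Finset.sum_congr rfl fun P _ ↦ ?_
  rw [AddMonoidHom.mulRight_apply, show (P.degree : ℤ) = 1 by exact_mod_cast hrat P, mul_one]

/-- **Riemann–Hurwitz formula** for `y : F → ℙ¹` in characteristic `0` with all places rational:
`2g - 2 = Σ_P diffOrd_P(y) = Σ_{v_P(y) ≥ 0} (v_P(y - y(P)) - 1) + Σ_{v_P(y) < 0} (v_P(y) - 1)`, i.e.
`2g - 2 = -2 [F : K(y)] + Σ_P (e_P - 1)` (Stichtenoth Cor. 3.4.14 with Dedekind's Thm. 3.5.1 (b),
Cor. 3.5.5: `deg Diff(F/K(y)) = Σ (e_P - 1)` since all ramification is tame in characteristic `0`).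
[cite: Stichtenoth2009, Cor. 3.4.14, Thm. 3.5.1, Cor. 3.5.5] -/
theorem finsum_diffOrd_eq (hrat : ∀ P : PlaceOver K F, P.IsRational) {y : F}
    (hy : y ∉ Set.range (algebraMap K F)) :
    ∑ᶠ P : PlaceOver K F, P.diffOrd y = 2 * genus K F - 2 := by
  rw [← degree_differentialDivisor (dOf_ne_zero hrat hy), Divisor.degree_eq_finsum hrat]
  exact finsum_congr fun P ↦ (differentialDivisor_dOf_apply hrat hy P).symm

end divisor

/-! ### Genus and dimension bounds from ramification data

The form in which the Riemann–Hurwitz formula is consumed (e.g. for `F = ℂ(X₀(N))`, `y = j`): lower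
bounds for `diffOrd_P(y)` at finitely many explicitly known places, containing all poles of `y`, bound
the genus from below (`le_genus_of_le_sum_diffOrd`), and an injective linear map from `L((dy))` bounds
the dimension of its target from below by `g` (`genus_le_finrank_of_injective`). -/

section bounds

variable [IsAlgFunctionField K F]

namespace PlaceOver

variable (P : PlaceOver K F)

/-- `diffOrd_P(y) ≥ n - 1` if `y ≡ c (mod tⁿ𝒪_P)` for a constant `c ≠ y` and `n ≥ 1` (at a place where
`y` is finite, `diffOrd_P(y) + 1 = v_P(y - y(P))` is the ramification index). [cite: Stichtenoth2009, Thm. 3.5.1] -/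
theorem le_diffOrd_of_sub_algebraMap_mem {y : F} {c : K} {n : ℤ} (hn : 1 ≤ n)
    (hc : y - algebraMap K F c ∈ P.ball n) (hyc : y ≠ algebraMap K F c) : n - 1 ≤ P.diffOrd y := by
  have hc1 : y - algebraMap K F c ∈ P.ball 1 := P.ball_antitone hn hc
  rw [P.diffOrd_of_sub_algebraMap_mem hc1]
  have := (P.mem_ball_iff_le_ord n (sub_ne_zero.2 hyc)).1 hc
  omega

/-- At a place where the non-constant `y` is finite, `diffOrd_P(y) ≥ 0` (rational place).
[cite: Stichtenoth2009, Thm. 3.5.1] -/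
theorem IsRational.diffOrd_nonneg {P : PlaceOver K F} (hP : P.IsRational) {y : F}
    (hy : y ∉ Set.range (algebraMap K F)) (hyP : y ∈ P.toValuationSubring) : 0 ≤ P.diffOrd y := by
  have h := P.le_diffOrd_of_sub_algebraMap_mem le_rfl (hP.sub_value_mem hyP) fun e ↦ hy ⟨_, e.symm⟩
  omega

omit [IsAlgFunctionField K F] in
/-- At a pole of order `e` (`v_P(y) = -e < 0`), `diffOrd_P(y) = v_P(y) - 1 = -e - 1`.
[cite: Stichtenoth2009, Remark 4.3.7] -/
theorem diffOrd_of_ord_neg {y : F} (h : P.ord y < 0) : P.diffOrd y = P.ord y - 1 := by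
  have hy0 : y ≠ 0 := by
    rintro rfl
    simp only [PlaceOver.ord, zero_mem, ↓reduceDIte] at h
    omega
  exact P.diffOrd_of_not_mem fun hmem ↦ (not_le.2 h) ((P.mem_toValuationSubring_iff_ord_nonneg hy0).1 hmem)

omit [IsAlgFunctionField K F] in
/-- `y` is finite at `P` unless `v_P(y) < 0`. [folklore] -/
theorem mem_toValuationSubring_of_ord_nonneg {y : F} (h : 0 ≤ P.ord y) : y ∈ P.toValuationSubring := by
  by_cases hy0 : y = 0
  · rw [hy0]; exact zero_mem _
  · exact (P.mem_toValuationSubring_iff_ord_nonneg hy0).2 h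

end PlaceOver

variable [IsIntegrallyClosedIn K F] [CharZero K]

/-- **Genus lower bound from partial ramification data.** If all places are rational (`char K = 0`,
`K` the full constant field), `y ∈ F ∖ K`, and `S` is a finite set of places outside of which `y` is
finite, then `Σ_{P ∈ S} diffOrd_P(y) ≤ 2g - 2` — the places not in `S` contribute `e_P - 1 ≥ 0` to the
Riemann–Hurwitz formula `Σ_P diffOrd_P(y) = 2g - 2`. [cite: Stichtenoth2009, Cor. 3.5.5] -/
theorem sum_diffOrd_le (hrat : ∀ P : PlaceOver K F, P.IsRational) {y : F}
    (hy : y ∉ Set.range (algebraMap K F)) (S : Finset (PlaceOver K F))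
    (hS : ∀ P : PlaceOver K F, y ∉ P.toValuationSubring → P ∈ S) :
    ∑ P ∈ S, P.diffOrd y ≤ 2 * (genus K F : ℤ) - 2 := by
  classical
  set T := (finite_setOf_diffOrd_ne_zero hrat hy).toFinset with hT
  have hsupp : Function.support (fun P : PlaceOver K F ↦ P.diffOrd y) ⊆ ↑(S ∪ T) := by
    intro P hP
    rw [Finset.coe_union, Set.mem_union, Finset.mem_coe, Finset.mem_coe, hT, Set.Finite.mem_toFinset]
    exact Or.inr hP
  rw [← finsum_diffOrd_eq hrat hy, finsum_eq_sum_of_support_subset _ hsupp,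
    ← Finset.sum_sdiff (Finset.subset_union_left (s₁ := S) (s₂ := T))]
  have h0 : 0 ≤ ∑ P ∈ (S ∪ T) \ S, P.diffOrd y := Finset.sum_nonneg fun P hP ↦ by
    have hPS : P ∉ S := (Finset.mem_sdiff.1 hP).2
    have hyP : y ∈ P.toValuationSubring := by_contra fun h ↦ hPS (hS P h)
    exact (hrat P).diffOrd_nonneg hy hyP
  linarith

/-- The same as a genus bound: if `2γ - 2 ≤ Σ_{P ∈ S} diffOrd_P(y)` for such an `S`, then `γ ≤ g`.
[cite: Stichtenoth2009, Cor. 3.5.5] -/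
theorem le_genus_of_le_sum_diffOrd (hrat : ∀ P : PlaceOver K F, P.IsRational) {y : F}
    (hy : y ∉ Set.range (algebraMap K F)) (S : Finset (PlaceOver K F))
    (hS : ∀ P : PlaceOver K F, y ∉ P.toValuationSubring → P ∈ S) {γ : ℤ}
    (hγ : 2 * γ - 2 ≤ ∑ P ∈ S, P.diffOrd y) : γ ≤ genus K F := by
  have := sum_diffOrd_le hrat hy S hS
  linarith

omit [IsAlgFunctionField K F] [CharZero K] in
/-- With `K` the full constant field, an element outside `K` is transcendental over `K`. [folklore] -/
theorem transcendental_of_not_mem_range {y : F} (hy : y ∉ Set.range (algebraMap K F)) :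
    Transcendental K y :=
  fun halg ↦ hy (IsIntegrallyClosedIn.isIntegral_iff.mp halg.isIntegral)

omit [IsIntegrallyClosedIn K F] [CharZero K] in
/-- The poles in any finite set `U` of poles of `y` have total order at most `[F : K(y)]`
(`Σ_{P ∈ U} -v_P(y) ≤ deg (y)_∞ = [F : K(y)]`, all places rational). [cite: Stichtenoth2009, Thm. 1.4.11] -/
theorem sum_neg_ord_le_finrank (hrat : ∀ P : PlaceOver K F, P.IsRational) {y : F}
    (hy : Transcendental K y) (U : Finset (PlaceOver K F)) (hU : ∀ P ∈ U, P.ord y < 0) :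
    ∑ P ∈ U, -P.ord y ≤ (Module.finrank K⟮y⟯ F : ℤ) := by
  classical
  have hy0 : y ≠ 0 := fun h ↦ hy (h ▸ isAlgebraic_zero)
  rw [← degree_negPart_principalDivisor_eq hy]
  set D := (principalDivisor K y)⁻ with hD
  have hDapp : ∀ Q, D Q = max (-Q.ord y) 0 := fun Q ↦ by
    rw [hD, Divisor.negPart_apply, principalDivisor_apply_of_ne_zero hy0]
  have hDU : ∀ Q ∈ U, D Q = -Q.ord y := fun Q hQ ↦ by
    rw [hDapp]; exact max_eq_left (by have := hU Q hQ; omega)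
  have hUsupp : U ⊆ D.support := fun Q hQ ↦ by
    rw [Finsupp.mem_support_iff, hDU Q hQ]; have := hU Q hQ; omega
  have hdeg : D.degree = ∑ Q ∈ D.support, D Q := by
    rw [Divisor.degree_apply, Finsupp.sum]
    refine Finset.sum_congr rfl fun Q _ ↦ ?_
    rw [show (Q.degree : ℤ) = 1 by exact_mod_cast hrat Q, mul_one]
  rw [hdeg, ← Finset.sum_congr rfl hDU]
  exact Finset.sum_le_sum_of_subset_of_nonneg hUsupp fun Q _ _ ↦ by rw [hDapp]; exact le_max_right _ _

omit [IsIntegrallyClosedIn K F] [CharZero K] in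
/-- **All poles are accounted for**: if `T` is a finite set of poles of `y` whose orders already add up
to at least `[F : K(y)]` (all places rational), then every pole of `y` lies in `T`.
[cite: Stichtenoth2009, Thm. 1.4.11] -/
theorem mem_of_ord_neg (hrat : ∀ P : PlaceOver K F, P.IsRational) {y : F} (hy : Transcendental K y)
    (T : Finset (PlaceOver K F)) (hT : ∀ P ∈ T, P.ord y < 0)
    (hdeg : (Module.finrank K⟮y⟯ F : ℤ) ≤ ∑ P ∈ T, -P.ord y) {P : PlaceOver K F} (hP : P.ord y < 0) :
    P ∈ T := by
  classical
  by_contra hPT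
  have h := sum_neg_ord_le_finrank hrat hy (insert P T) (by
    rintro Q hQ
    rcases Finset.mem_insert.1 hQ with rfl | hQ
    exacts [hP, hT Q hQ])
  rw [Finset.sum_insert hPT] at h
  omega

/-- **Genus lower bound from explicit ramification data** (the form used for `ℂ(X₀(N))`). Let all places
be rational, `char K = 0`, `K` the full constant field, `y ∈ F ∖ K`; let `S` be finitely many places
where `y` is finite and `T` finitely many poles of `y` with `[F : K(y)] ≤ μ ≤ Σ_{P ∈ T} (-v_P(y))`
(so `T` is the set of all poles and `[F : K(y)] = μ`). Then
`2g - 2 ≥ Σ_{P ∈ S} diffOrd_P(y) - μ - #T`; i.e. `2γ - 2 ≤ Σ_{P ∈ S} diffOrd_P(y) - μ - #T ⇒ γ ≤ g`.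
(Riemann–Hurwitz: `2g - 2 = -2μ + Σ_{finite P}(e_P - 1) + Σ_{poles}(e_P - 1)` and
`Σ_{poles} e_P = μ`.) [cite: Stichtenoth2009, Cor. 3.5.5, Thm. 1.4.11] -/
theorem le_genus_of_ramification (hrat : ∀ P : PlaceOver K F, P.IsRational) {y : F}
    (hy : y ∉ Set.range (algebraMap K F)) (S T : Finset (PlaceOver K F))
    (hS : ∀ P ∈ S, 0 ≤ P.ord y) (hT : ∀ P ∈ T, P.ord y < 0) {μ : ℤ}
    (hμ : (Module.finrank K⟮y⟯ F : ℤ) ≤ μ) (hTμ : μ ≤ ∑ P ∈ T, -P.ord y) {γ : ℤ}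
    (hγ : 2 * γ - 2 ≤ (∑ P ∈ S, P.diffOrd y) - μ - T.card) : γ ≤ genus K F := by
  classical
  have hyt : Transcendental K y := transcendental_of_not_mem_range hy
  have hy0 : y ≠ 0 := fun h ↦ hyt (h ▸ isAlgebraic_zero)
  have hdisj : Disjoint S T := Finset.disjoint_left.2 fun P hPS hPT ↦ by
    have := hS P hPS; have := hT P hPT; omega
  refine le_genus_of_le_sum_diffOrd hrat hy (S ∪ T) (fun P hP ↦ ?_) ?_
  · refine Finset.mem_union_right _ (mem_of_ord_neg hrat hyt T hT (hμ.trans hTμ) ?_)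
    by_contra h
    exact hP (P.mem_toValuationSubring_of_ord_nonneg (not_lt.1 h))
  · rw [Finset.sum_union hdisj]
    have hTsum : ∑ P ∈ T, P.diffOrd y = -(∑ P ∈ T, -P.ord y) - T.card := by
      rw [Finset.card_eq_sum_ones, Nat.cast_sum, Nat.cast_one, ← Finset.sum_neg_distrib,
        ← Finset.sum_sub_distrib]
      exact Finset.sum_congr rfl fun P hP ↦ by rw [P.diffOrd_of_ord_neg (hT P hP)]; ring
    have hle := sum_neg_ord_le_finrank hrat hyt T hT
    rw [hTsum]
    linarith

/-- Membership in the canonical Riemann–Roch space `L((dy))`: for `x ≠ 0`,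
`x ∈ L((dy)) ↔ ∀ P, v_P(x) ≥ -diffOrd_P(y)` (i.e. the "differential `x dy`" is holomorphic).
[cite: Stichtenoth2009, Def. 1.5.11, Remark 4.3.7] -/
theorem mem_riemannRochSpace_differentialDivisor_dOf_iff (hrat : ∀ P : PlaceOver K F, P.IsRational)
    {y : F} (hy : y ∉ Set.range (algebraMap K F)) {x : F} (hx : x ≠ 0) :
    x ∈ riemannRochSpace (differentialDivisor (dOf K y)) ↔ ∀ P : PlaceOver K F, -P.diffOrd y ≤ P.ord x := by
  rw [mem_riemannRochSpace_iff]
  simp only [PlaceOver.valuation_le_pow_iff_holds _ hx, differentialDivisor_dOf_apply hrat hy]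

/-- **Dimension bound.** An injective `K`-linear map from the canonical space `L((dy))` into a
finite-dimensional space `V` gives `g = ℓ((dy)) ≤ dim_K V` (used with `V = S₂(Γ₀(N))`,
`x ↦ x · j′`). [cite: Stichtenoth2009, Cor. 1.5.16] -/
theorem genus_le_finrank_of_injective (hrat : ∀ P : PlaceOver K F, P.IsRational) {y : F}
    (hy : y ∉ Set.range (algebraMap K F)) {V : Type*} [AddCommGroup V] [Module K V]
    [FiniteDimensional K V] (f : riemannRochSpace (differentialDivisor (dOf K y)) →ₗ[K] V)
    (hf : Function.Injective f) : genus K F ≤ Module.finrank K V := by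
  rw [← (isCanonical_differentialDivisor_dOf hrat hy).2.2]
  exact LinearMap.finrank_le_finrank_of_injective hf

/-- `le_genus_of_ramification` combined with `genus_le_finrank_of_injective`: explicit ramification
data and an injective linear map `L((dy)) → V` give `γ ≤ dim_K V`.
[cite: Stichtenoth2009, Cor. 3.5.5, Cor. 1.5.16] -/
theorem le_finrank_of_ramification_of_injective (hrat : ∀ P : PlaceOver K F, P.IsRational) {y : F}
    (hy : y ∉ Set.range (algebraMap K F)) (S T : Finset (PlaceOver K F))
    (hS : ∀ P ∈ S, 0 ≤ P.ord y) (hT : ∀ P ∈ T, P.ord y < 0) {μ : ℤ}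
    (hμ : (Module.finrank K⟮y⟯ F : ℤ) ≤ μ) (hTμ : μ ≤ ∑ P ∈ T, -P.ord y) {γ : ℤ}
    (hγ : 2 * γ - 2 ≤ (∑ P ∈ S, P.diffOrd y) - μ - T.card)
    {V : Type*} [AddCommGroup V] [Module K V] [FiniteDimensional K V]
    (f : riemannRochSpace (differentialDivisor (dOf K y)) →ₗ[K] V) (hf : Function.Injective f) :
    γ ≤ Module.finrank K V :=
  (le_genus_of_ramification hrat hy S T hS hT hμ hTμ hγ).trans
    (Int.ofNat_le.2 (genus_le_finrank_of_injective hrat hy f hf))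

omit [IsAlgFunctionField K F] [IsIntegrallyClosedIn K F] [CharZero K] in
/-- `K((y - a)⁻¹) = K(y)` inside `F`. [folklore] -/
theorem adjoin_inv_sub_algebraMap_eq (y : F) (a : K) :
    K⟮(y - algebraMap K F a)⁻¹⟯ = K⟮y⟯ := by
  apply le_antisymm
  · rw [IntermediateField.adjoin_simple_le_iff]
    exact inv_mem (sub_mem (IntermediateField.mem_adjoin_simple_self K y) (algebraMap_mem _ a))
  · rw [IntermediateField.adjoin_simple_le_iff]
    have hmem : (y - algebraMap K F a)⁻¹ ∈ K⟮(y - algebraMap K F a)⁻¹⟯ :=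
      IntermediateField.mem_adjoin_simple_self K _
    have h2 : ((y - algebraMap K F a)⁻¹)⁻¹ + algebraMap K F a = y := by rw [inv_inv, sub_add_cancel]
    have : ((y - algebraMap K F a)⁻¹)⁻¹ + algebraMap K F a ∈ K⟮(y - algebraMap K F a)⁻¹⟯ :=
      add_mem (inv_mem hmem) (algebraMap_mem _ a)
    rwa [h2] at this

omit [CharZero K] in
/-- **All poles, exactly**: if the finite set `U` consists of poles of `y ∉ K` and contains every pole,
then `Σ_{P ∈ U} -v_P(y) = [F : K(y)]` (all places rational; `deg (y)_∞ = [F : K(y)]`).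
[cite: Stichtenoth2009, Thm. 1.4.11] -/
theorem sum_neg_ord_eq_finrank (hrat : ∀ P : PlaceOver K F, P.IsRational) {y : F}
    (hy : y ∉ Set.range (algebraMap K F)) (U : Finset (PlaceOver K F)) (hU : ∀ P ∈ U, P.ord y < 0)
    (hcomp : ∀ P : PlaceOver K F, P.ord y < 0 → P ∈ U) :
    ∑ P ∈ U, -P.ord y = (Module.finrank K⟮y⟯ F : ℤ) := by
  classical
  have hyt : Transcendental K y := transcendental_of_not_mem_range hy
  have hy0 : y ≠ 0 := fun h ↦ hyt (h ▸ isAlgebraic_zero)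
  rw [← degree_negPart_principalDivisor_eq hyt]
  set D := (principalDivisor K y)⁻ with hD
  have hDapp : ∀ Q, D Q = max (-Q.ord y) 0 := fun Q ↦ by
    rw [hD, Divisor.negPart_apply, principalDivisor_apply_of_ne_zero hy0]
  have hsupp : D.support = U := by
    ext Q
    rw [Finsupp.mem_support_iff, hDapp]
    constructor
    · intro h
      apply hcomp
      by_contra hq
      exact h (max_eq_right (by omega))
    · intro hQ
      have := hU Q hQ
      rw [max_eq_left (by omega)]
      omega
  rw [Divisor.degree_apply, Finsupp.sum, hsupp]
  refine Finset.sum_congr rfl fun Q hQ ↦ ?_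
  rw [show (Q.degree : ℤ) = 1 by exact_mod_cast hrat Q, mul_one, hDapp]
  exact (max_eq_left (by have := hU Q hQ; omega)).symm

omit [CharZero K] in
/-- **All zeros of `y - a`, exactly**: if the finite set `U` consists of zeros of `y - a` (`y ∉ K`) and
contains every zero, then `Σ_{P ∈ U} v_P(y - a) = [F : K(y)]` (`deg (y - a)_0 = deg ((y - a)⁻¹)_∞ =
[F : K((y - a)⁻¹)] = [F : K(y)]`). [cite: Stichtenoth2009, Thm. 1.4.11] -/
theorem sum_ord_sub_eq_finrank (hrat : ∀ P : PlaceOver K F, P.IsRational) {y : F}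
    (hy : y ∉ Set.range (algebraMap K F)) (a : K) (U : Finset (PlaceOver K F))
    (hU : ∀ P ∈ U, 0 < P.ord (y - algebraMap K F a))
    (hcomp : ∀ P : PlaceOver K F, 0 < P.ord (y - algebraMap K F a) → P ∈ U) :
    ∑ P ∈ U, P.ord (y - algebraMap K F a) = (Module.finrank K⟮y⟯ F : ℤ) := by
  set x := (y - algebraMap K F a)⁻¹ with hx
  have hya : y - algebraMap K F a ≠ 0 := fun e ↦ hy ⟨a, (sub_eq_zero.1 e).symm⟩
  have hxK : x ∉ Set.range (algebraMap K F) := by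
    rintro ⟨c, hc⟩
    apply hy
    refine ⟨c⁻¹ + a, ?_⟩
    rw [map_add, map_inv₀, hc, hx, inv_inv, sub_add_cancel]
  have hordx : ∀ P : PlaceOver K F, P.ord x = -P.ord (y - algebraMap K F a) := fun P ↦ by
    rw [hx, P.ord_inv hya]
  rw [← adjoin_inv_sub_algebraMap_eq y a, ← hx,
    ← sum_neg_ord_eq_finrank hrat hxK U (fun P hP ↦ by rw [hordx]; have := hU P hP; omega)
      (fun P hP ↦ hcomp P (by rw [hordx] at hP; omega))]
  exact Finset.sum_congr rfl fun P _ ↦ by rw [hordx, neg_neg]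

omit [IsAlgFunctionField K F] [IsIntegrallyClosedIn K F] [CharZero K] in
/-- **Completeness of a fibre by the norm argument.** Let `Ps` be finitely many places and `c ∈ K`.
Suppose every `u ∈ F` with `u ≡ 1 (mod t_P 𝒪_P)` for all `P ∈ Ps` satisfies a monic relation
`u^{n+1} + Σ_{k ≤ n} s_k u^k = 0` whose coefficients `s_k` are integral at every place `Q` over `c`
(`v_Q(y - c) > 0`) and whose constant coefficient `s_0` is a unit at every such `Q`. Then every place over
`c` belongs to `Ps`: otherwise weak approximation gives `u` with moreover `u ≡ 0` at a place `P ∉ Ps`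
over `c`, and `s_0 = -u (uⁿ + Σ_{k<n} s_{k+1} u^k)` would not be a unit at `P`. (For
`F = ℂ(X₀(N))`, `y = j`, `Ps` = the places at the points `γ_v τ₀` over `c = j(τ₀)`: `s_k` = the
elementary symmetric functions of the `u ∘ γ_v`, level-one modular functions regular at `τ₀`, i.e.
`p(j)/q(j)` with `q(c) ≠ 0` — integral at every place over `c` by `PlaceOver.aeval_sub_mem_ball` — and
`s_0(τ₀) = ∏_v u(γ_v τ₀) = 1`.) [folklore] -/
theorem mem_of_monic_relation (Ps : Finset (PlaceOver K F)) {y : F} {c : K}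
    (hrel : ∀ u : F, (∀ P ∈ Ps, u - 1 ∈ P.ball 1) →
      ∃ (n : ℕ) (s : ℕ → F), u ^ (n + 1) + ∑ k ∈ Finset.range (n + 1), s k * u ^ k = 0 ∧
        (∀ k, ∀ Q : PlaceOver K F, 0 < Q.ord (y - algebraMap K F c) → s k ∈ Q.toValuationSubring) ∧
        ∀ Q : PlaceOver K F, 0 < Q.ord (y - algebraMap K F c) → Q.valuation (s 0) = 1)
    {P : PlaceOver K F} (hP : 0 < P.ord (y - algebraMap K F c)) : P ∈ Ps := by
  classical
  by_contra hPPs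
  obtain ⟨u, hu⟩ := PlaceOver.exists_forall_valuation_sub_le (insert P Ps) (fun Q ↦ if Q = P then 0 else 1)
    (fun _ ↦ 1)
  have huP : P.valuation u < 1 := by
    have := hu P (Finset.mem_insert_self _ _)
    rw [if_pos rfl, sub_zero, zpow_one] at this
    exact this.trans_lt P.valuation_uniformizer_lt_one
  have hu1 : ∀ Q ∈ Ps, u - 1 ∈ Q.ball 1 := fun Q hQ ↦ by
    have hQP : Q ≠ P := fun h ↦ hPPs (h ▸ hQ)
    have := hu Q (Finset.mem_insert_of_mem hQ)
    rw [if_neg hQP] at this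
    exact (Q.mem_ball_iff 1 _).2 this
  obtain ⟨n, s, hrel0, hsO, hs0⟩ := hrel u hu1
  have huO : P.valuation u ≤ 1 := huP.le
  -- isolate the constant coefficient
  have hs0eq : s 0 = -(u * (u ^ n + ∑ k ∈ Finset.range n, s (k + 1) * u ^ k)) := by
    rw [Finset.sum_range_succ'] at hrel0
    simp only [pow_zero, mul_one] at hrel0
    have : s 0 = -(u ^ (n + 1) + ∑ k ∈ Finset.range n, s (k + 1) * u ^ (k + 1)) := by
      linear_combination hrel0
    rw [this, mul_add, Finset.mul_sum, pow_succ']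
    congr 2
    exact Finset.sum_congr rfl fun k _ ↦ by ring
  have hle : P.valuation (u ^ n + ∑ k ∈ Finset.range n, s (k + 1) * u ^ k) ≤ 1 := by
    refine (Valuation.map_add _ _ _).trans (max_le ?_ (Valuation.map_sum_le _ fun k _ ↦ ?_))
    · rw [Valuation.map_pow]; exact pow_le_one₀ zero_le huO
    · rw [Valuation.map_mul, Valuation.map_pow]
      exact mul_le_one' ((P.toValuationSubring.valuation_le_one_iff _).2 (hsO _ P hP))
        (pow_le_one₀ zero_le huO)
  have hlt : P.valuation (s 0) < 1 := by
    rw [hs0eq, Valuation.map_neg, Valuation.map_mul]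
    exact mul_lt_one_of_lt_of_le huP hle
  exact hlt.ne (hs0 P hP)

omit [IsAlgFunctionField K F] [IsIntegrallyClosedIn K F] [CharZero K] in
/-- `ord_P 0 = 0` (junk value). [folklore] -/
theorem PlaceOver.ord_zero (P : PlaceOver K F) : P.ord (0 : F) = 0 := by
  simp only [PlaceOver.ord, zero_mem, ↓reduceDIte]
  have h0 : (⟨(0 : F), zero_mem _⟩ : P.toValuationSubring) = 0 := rfl
  rw [h0, IsDiscreteValuationRing.addVal_zero, ENat.toNat_top, Nat.cast_zero]

omit [IsAlgFunctionField K F] [IsIntegrallyClosedIn K F] [CharZero K] in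
/-- `mem_of_monic_relation` **at infinity** (`y⁻¹` over `0`): if every `u ≡ 1` at the places of `Ps`
satisfies a monic relation with coefficients integral at every pole of `y` and constant coefficient a
unit at every pole, then every pole of `y` is in `Ps`. (For `ℂ(X₀(N))`: `Ps` = the cusp places, the
coefficients are level-one modular functions holomorphic at the cusp `∞`, i.e. polynomials in `1/j` near
`j = ∞` up to units, and `s_0(∞) = ∏_v u(γ_v ∞) = 1`.) [folklore] -/
theorem mem_of_monic_relation_pole (Ps : Finset (PlaceOver K F)) {y : F}
    (hrel : ∀ u : F, (∀ P ∈ Ps, u - 1 ∈ P.ball 1) →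
      ∃ (n : ℕ) (s : ℕ → F), u ^ (n + 1) + ∑ k ∈ Finset.range (n + 1), s k * u ^ k = 0 ∧
        (∀ k, ∀ Q : PlaceOver K F, Q.ord y < 0 → s k ∈ Q.toValuationSubring) ∧
        ∀ Q : PlaceOver K F, Q.ord y < 0 → Q.valuation (s 0) = 1)
    {P : PlaceOver K F} (hP : P.ord y < 0) : P ∈ Ps := by
  have key : ∀ Q : PlaceOver K F, 0 < Q.ord (y⁻¹ - algebraMap K F 0) ↔ Q.ord y < 0 := fun Q ↦ by
    rw [map_zero, sub_zero]
    by_cases hy0 : y = 0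
    · rw [hy0, inv_zero, Q.ord_zero]
    · rw [Q.ord_inv hy0]; omega
  exact mem_of_monic_relation Ps (y := y⁻¹) (c := 0) (fun u hu ↦ by
    obtain ⟨n, s, h1, h2, h3⟩ := hrel u hu
    exact ⟨n, s, h1, fun k Q hQ ↦ h2 k Q ((key Q).1 hQ), fun Q hQ ↦ h3 Q ((key Q).1 hQ)⟩) ((key P).2 hP)

omit [IsIntegrallyClosedIn K F] [CharZero K] in
/-- Coefficients for `mem_of_monic_relation`: at a place `Q` over `c` (`v_Q(y - c) > 0`), a rational
expression `p(y)/q(y)` with `q(c) ≠ 0` is integral, with residue `p(c)/q(c)`; in particular it is a unit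
if also `p(c) ≠ 0`. Here: `p(y) ≡ p(c) (mod t_Q)`. [folklore] -/
theorem PlaceOver.aeval_sub_mem_ball (Q : PlaceOver K F) {y : F} {c : K}
    (hQ : 0 < Q.ord (y - algebraMap K F c)) (hyc : y ≠ algebraMap K F c) (p : Polynomial K) :
    Polynomial.aeval y p - algebraMap K F (p.eval c) ∈ Q.ball 1 := by
  have hyc' : y - algebraMap K F c ∈ Q.ball 1 := (Q.mem_ball_iff_le_ord 1 (sub_ne_zero.2 hyc)).2 hQ
  -- every polynomial in `y` is integral at `Q`
  have hyO : Q.valuation y ≤ 1 := by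
    have h1 : Q.valuation (y - algebraMap K F c) ≤ 1 :=
      ((Q.mem_ball_iff 1 _).1 hyc').trans (by rw [zpow_one]; exact Q.valuation_uniformizer_lt_one.le)
    have h2 : Q.valuation (algebraMap K F c) ≤ 1 :=
      Q.toValuationSubring.valuation_le_one ⟨_, Q.algebraMap_mem c⟩
    simpa using (Valuation.map_add Q.valuation (y - algebraMap K F c) (algebraMap K F c)).trans
      (max_le h1 h2)
  have hpoly : ∀ r : Polynomial K, Q.valuation (Polynomial.aeval y r) ≤ 1 := fun r ↦ by
    induction r using Polynomial.induction_on' with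
    | add p q hp hq => rw [map_add]; exact (Valuation.map_add _ _ _).trans (max_le hp hq)
    | monomial k a =>
      rw [Polynomial.aeval_monomial, Valuation.map_mul, Valuation.map_pow]
      exact mul_le_one' (Q.toValuationSubring.valuation_le_one ⟨_, Q.algebraMap_mem a⟩)
        (pow_le_one₀ zero_le hyO)
  obtain ⟨r, hr⟩ := Polynomial.X_sub_C_dvd_sub_C_eval (p := p) (a := c)
  have : Polynomial.aeval y p - algebraMap K F (p.eval c) =
      (y - algebraMap K F c) * Polynomial.aeval y r := by
    have h := congrArg (Polynomial.aeval y) hr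
    simp only [map_sub, Polynomial.aeval_C, map_mul, Polynomial.aeval_X] at h
    exact h
  rw [this, mul_comm]
  have hrO := hpoly r
  rw [Q.mem_ball_iff, Valuation.map_mul, zpow_one]
  have := (Q.mem_ball_iff 1 _).1 hyc'
  rw [zpow_one] at this
  exact (mul_le_mul' hrO this).trans (by rw [one_mul])

omit [IsIntegrallyClosedIn K F] [CharZero K] in
/-- At a place `Q` over `c`, `p(y)` is integral for every polynomial `p`. [folklore] -/
theorem PlaceOver.valuation_aeval_le_one (Q : PlaceOver K F) {y : F} {c : K}
    (hQ : 0 < Q.ord (y - algebraMap K F c)) (hyc : y ≠ algebraMap K F c) (p : Polynomial K) :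
    Q.valuation (Polynomial.aeval y p) ≤ 1 := by
  have hp' := Q.aeval_sub_mem_ball hQ hyc p
  have h1 : Q.valuation (algebraMap K F (p.eval c)) ≤ 1 :=
    Q.toValuationSubring.valuation_le_one ⟨_, Q.algebraMap_mem _⟩
  have h2 : Q.valuation (Polynomial.aeval y p - algebraMap K F (p.eval c)) ≤ 1 :=
    ((Q.mem_ball_iff 1 _).1 hp').trans (by rw [zpow_one]; exact Q.valuation_uniformizer_lt_one.le)
  simpa using (Valuation.map_add Q.valuation _ _).trans (max_le h2 h1)

omit [IsIntegrallyClosedIn K F] [CharZero K] in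
/-- At a place `Q` over `c`, `q(y)` is a unit when `q(c) ≠ 0` (`q(y) ≡ q(c) ≠ 0`). [folklore] -/
theorem PlaceOver.valuation_aeval_eq_one (Q : PlaceOver K F) {y : F} {c : K}
    (hQ : 0 < Q.ord (y - algebraMap K F c)) (hyc : y ≠ algebraMap K F c) (q : Polynomial K)
    (hq : q.eval c ≠ 0) : Q.valuation (Polynomial.aeval y q) = 1 := by
  have hq' := Q.aeval_sub_mem_ball hQ hyc q
  have h1 : Q.valuation (algebraMap K F (q.eval c)) = 1 := by
    rw [Q.valuation_eq_zpow_ord ((map_ne_zero _).2 hq), ord_algebraMap_holds Q hq, zpow_zero]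
  have hlt : Q.valuation (Polynomial.aeval y q - algebraMap K F (q.eval c)) <
      Q.valuation (algebraMap K F (q.eval c)) := by
    rw [h1]
    exact (Q.valuation_lt_one_iff_le _).2 (by simpa [zpow_one] using (Q.mem_ball_iff 1 _).1 hq')
  have := Valuation.map_add_eq_of_lt_left Q.valuation hlt
  rwa [add_sub_cancel, h1] at this

omit [IsIntegrallyClosedIn K F] [CharZero K] in
/-- At a place `Q` over `c`, `p(y)/q(y)` with `q(c) ≠ 0` is integral (coefficients for
`mem_of_monic_relation`). [folklore] -/
theorem PlaceOver.aeval_div_aeval_mem (Q : PlaceOver K F) {y : F} {c : K}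
    (hQ : 0 < Q.ord (y - algebraMap K F c)) (hyc : y ≠ algebraMap K F c) (p q : Polynomial K)
    (hq : q.eval c ≠ 0) : Polynomial.aeval y p / Polynomial.aeval y q ∈ Q.toValuationSubring := by
  rw [← Q.toValuationSubring.valuation_le_one_iff]
  change Q.valuation _ ≤ 1
  rw [map_div₀, Q.valuation_aeval_eq_one hQ hyc q hq, div_one]
  exact Q.valuation_aeval_le_one hQ hyc p

omit [IsIntegrallyClosedIn K F] [CharZero K] in
/-- At a place `Q` over `c`, `p(y)/q(y)` with `p(c) ≠ 0 ≠ q(c)` is a unit (the constant coefficient in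
`mem_of_monic_relation`). [folklore] -/
theorem PlaceOver.valuation_aeval_div_aeval_eq_one (Q : PlaceOver K F) {y : F} {c : K}
    (hQ : 0 < Q.ord (y - algebraMap K F c)) (hyc : y ≠ algebraMap K F c) (p q : Polynomial K)
    (hp : p.eval c ≠ 0) (hq : q.eval c ≠ 0) :
    Q.valuation (Polynomial.aeval y p / Polynomial.aeval y q) = 1 := by
  rw [map_div₀, Q.valuation_aeval_eq_one hQ hyc q hq, Q.valuation_aeval_eq_one hQ hyc p hp, div_one]

/-- **Genus lower bound from complete fibres over two values and infinity** (the second consumable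
form of Riemann–Hurwitz, needing no ramification indices): all places rational, `char K = 0`, `K` the
full constant field, `y ∈ F ∖ K`, `a ≠ b` in `K`; if the finite sets `S_a ⊇ {P : v_P(y - a) > 0}`,
`S_b ⊇ {P : v_P(y - b) > 0}` and `T ⊇ {poles of y}` are given, then
`[F : K(y)] - #S_a - #S_b - #T ≤ 2g - 2` — since `Σ_{P | a}(e_P - 1) = [F : K(y)] - r_a`,
`Σ_{P | b}(e_P - 1) = [F : K(y)] - r_b`, `Σ_{poles}(-e_P - 1) = -[F : K(y)] - r_∞` and all other
places contribute `e_P - 1 ≥ 0`. [cite: Stichtenoth2009, Cor. 3.5.5, Thm. 1.4.11] -/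
theorem finrank_sub_card_le_genus (hrat : ∀ P : PlaceOver K F, P.IsRational) {y : F}
    (hy : y ∉ Set.range (algebraMap K F)) {a b : K} (hab : a ≠ b) (Sa Sb T : Finset (PlaceOver K F))
    (hSa : ∀ P : PlaceOver K F, 0 < P.ord (y - algebraMap K F a) → P ∈ Sa)
    (hSb : ∀ P : PlaceOver K F, 0 < P.ord (y - algebraMap K F b) → P ∈ Sb)
    (hT : ∀ P : PlaceOver K F, P.ord y < 0 → P ∈ T) :
    (Module.finrank K⟮y⟯ F : ℤ) - Sa.card - Sb.card - T.card ≤ 2 * genus K F - 2 := by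
  classical
  have hy0 : y ≠ 0 := fun e ↦ hy ⟨0, by simp [e]⟩
  have hya : y - algebraMap K F a ≠ 0 := fun e ↦ hy ⟨a, (sub_eq_zero.1 e).symm⟩
  have hyb : y - algebraMap K F b ≠ 0 := fun e ↦ hy ⟨b, (sub_eq_zero.1 e).symm⟩
  -- the exact fibres
  set Ua := Sa.filter fun P ↦ 0 < P.ord (y - algebraMap K F a) with hUa
  set Ub := Sb.filter fun P ↦ 0 < P.ord (y - algebraMap K F b) with hUb
  set Ui := T.filter fun P ↦ P.ord y < 0 with hUi
  have mUa : ∀ P, P ∈ Ua ↔ 0 < P.ord (y - algebraMap K F a) := fun P ↦ by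
    rw [hUa, Finset.mem_filter]; exact ⟨fun h ↦ h.2, fun h ↦ ⟨hSa P h, h⟩⟩
  have mUb : ∀ P, P ∈ Ub ↔ 0 < P.ord (y - algebraMap K F b) := fun P ↦ by
    rw [hUb, Finset.mem_filter]; exact ⟨fun h ↦ h.2, fun h ↦ ⟨hSb P h, h⟩⟩
  have mUi : ∀ P, P ∈ Ui ↔ P.ord y < 0 := fun P ↦ by
    rw [hUi, Finset.mem_filter]; exact ⟨fun h ↦ h.2, fun h ↦ ⟨hT P h, h⟩⟩
  -- membership in balls and disjointness
  have ballA : ∀ P, P ∈ Ua → y - algebraMap K F a ∈ P.ball 1 := fun P hP ↦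
    (P.mem_ball_iff_le_ord 1 hya).2 ((mUa P).1 hP)
  have ballB : ∀ P, P ∈ Ub → y - algebraMap K F b ∈ P.ball 1 := fun P hP ↦
    (P.mem_ball_iff_le_ord 1 hyb).2 ((mUb P).1 hP)
  have memO : ∀ {P : PlaceOver K F} {c : K}, y - algebraMap K F c ∈ P.ball 1 →
      y ∈ P.toValuationSubring := fun {P c} hc ↦ by
    have h0 : y - algebraMap K F c ∈ P.toValuationSubring :=
      (P.mem_ball_zero_iff _).1 (P.ball_antitone (show (0 : ℤ) ≤ 1 by omega) hc)
    simpa using add_mem h0 (P.algebraMap_mem c)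
  have hdab : Disjoint Ua Ub := Finset.disjoint_left.2 fun P h1 h2 ↦
    hab (P.eq_of_sub_algebraMap_mem (ballA P h1) (ballB P h2))
  have hfin : ∀ P ∈ Ua ∪ Ub, 0 ≤ P.ord y := fun P hP ↦ by
    rcases Finset.mem_union.1 hP with h | h
    · exact (P.mem_toValuationSubring_iff_ord_nonneg hy0).1 (memO (ballA P h))
    · exact (P.mem_toValuationSubring_iff_ord_nonneg hy0).1 (memO (ballB P h))
  have hdi : Disjoint (Ua ∪ Ub) Ui := Finset.disjoint_left.2 fun P h1 h2 ↦ by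
    have := hfin P h1; have := (mUi P).1 h2; omega
  -- the three exact sums
  have eA : ∑ P ∈ Ua, P.diffOrd y = (Module.finrank K⟮y⟯ F : ℤ) - Ua.card := by
    rw [← sum_ord_sub_eq_finrank hrat hy a Ua (fun P hP ↦ (mUa P).1 hP) (fun P hP ↦ (mUa P).2 hP),
      Finset.card_eq_sum_ones, Nat.cast_sum, Nat.cast_one, ← Finset.sum_sub_distrib]
    exact Finset.sum_congr rfl fun P hP ↦ P.diffOrd_of_sub_algebraMap_mem (ballA P hP)
  have eB : ∑ P ∈ Ub, P.diffOrd y = (Module.finrank K⟮y⟯ F : ℤ) - Ub.card := by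
    rw [← sum_ord_sub_eq_finrank hrat hy b Ub (fun P hP ↦ (mUb P).1 hP) (fun P hP ↦ (mUb P).2 hP),
      Finset.card_eq_sum_ones, Nat.cast_sum, Nat.cast_one, ← Finset.sum_sub_distrib]
    exact Finset.sum_congr rfl fun P hP ↦ P.diffOrd_of_sub_algebraMap_mem (ballB P hP)
  have eI : ∑ P ∈ Ui, P.diffOrd y = -(Module.finrank K⟮y⟯ F : ℤ) - Ui.card := by
    rw [← sum_neg_ord_eq_finrank hrat hy Ui (fun P hP ↦ (mUi P).1 hP) (fun P hP ↦ (mUi P).2 hP),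
      Finset.card_eq_sum_ones, Nat.cast_sum, Nat.cast_one, ← Finset.sum_neg_distrib,
      ← Finset.sum_sub_distrib]
    exact Finset.sum_congr rfl fun P hP ↦ by rw [P.diffOrd_of_ord_neg ((mUi P).1 hP)]; ring
  -- Riemann–Hurwitz as an inequality over `Ua ∪ Ub ∪ Ui ⊇ poles`
  have key := sum_diffOrd_le hrat hy ((Ua ∪ Ub) ∪ Ui) fun P hP ↦ by
    refine Finset.mem_union_right _ ((mUi P).2 ?_)
    by_contra h
    exact hP (P.mem_toValuationSubring_of_ord_nonneg (not_lt.1 h))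
  rw [Finset.sum_union hdi, Finset.sum_union hdab, eA, eB, eI] at key
  have cA : Ua.card ≤ Sa.card := Finset.card_filter_le _ _
  have cB : Ub.card ≤ Sb.card := Finset.card_filter_le _ _
  have cI : Ui.card ≤ T.card := Finset.card_filter_le _ _
  omega

/-- `finrank_sub_card_le_genus` as a dimension bound: with `μ ≤ [F : K(y)]`, `2 #S_a ≤ μ + ν₂`,
`3 #S_b ≤ μ + 2ν₃`, `#T ≤ ν_∞`, `12γ + 3ν₂ + 4ν₃ + 6ν_∞ ≤ 12 + μ` and an injective linear map
`L((dy)) → V`: `γ ≤ dim_K V`. (For `X₀(N)`: `S_{1728}`, `S_0`, `T` = the places at the `Γ₀(N)`-orbits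
on `SL₂(ℤ)i`, `SL₂(ℤ)ρ` and at the cusps — `(μ + ν₂)/2`, `(μ + 2ν₃)/3`, `ν_∞` of them — once every place
over `1728`, `0`, `∞` is known to be one of these, and `μ = [SL₂(ℤ) : Γ₀(N)] ≤ [K_N : ℂ(j)]`.)
[cite: Stichtenoth2009, Cor. 3.5.5, Cor. 1.5.16] -/
theorem le_finrank_of_complete_fibres (hrat : ∀ P : PlaceOver K F, P.IsRational) {y : F}
    (hy : y ∉ Set.range (algebraMap K F)) {a b : K} (hab : a ≠ b) (Sa Sb T : Finset (PlaceOver K F))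
    (hSa : ∀ P : PlaceOver K F, 0 < P.ord (y - algebraMap K F a) → P ∈ Sa)
    (hSb : ∀ P : PlaceOver K F, 0 < P.ord (y - algebraMap K F b) → P ∈ Sb)
    (hT : ∀ P : PlaceOver K F, P.ord y < 0 → P ∈ T) {μ ν₂ ν₃ νi γ : ℕ}
    (hμ : μ ≤ Module.finrank K⟮y⟯ F) (h₂ : 2 * Sa.card ≤ μ + ν₂) (h₃ : 3 * Sb.card ≤ μ + 2 * ν₃)
    (hi : T.card ≤ νi) (hγ : 12 * γ + 3 * ν₂ + 4 * ν₃ + 6 * νi ≤ 12 + μ)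
    {V : Type*} [AddCommGroup V] [Module K V] [FiniteDimensional K V]
    (f : riemannRochSpace (differentialDivisor (dOf K y)) →ₗ[K] V) (hf : Function.Injective f) :
    γ ≤ Module.finrank K V := by
  have h1 := finrank_sub_card_le_genus hrat hy hab Sa Sb T hSa hSb hT
  have h2 := genus_le_finrank_of_injective hrat hy f hf
  have h3 : (γ : ℤ) ≤ genus K F := by omega
  exact (Int.ofNat_le.1 (by exact_mod_cast h3)).trans h2

/-- **Covers ramified to order `2` and `3` over two values** (the shape of `j : X₀(N) → ℙ¹`). Let all
places be rational, `char K = 0`, `K` the full constant field, `y ∈ F ∖ K` with `[F : K(y)] ≤ μ`; let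
`S₂` be finitely many places with `y ≡ a (mod t²𝒪_P)`, `S₃` finitely many places with
`y ≡ b (mod t³𝒪_P)` (`a ≠ b`), and `T` finitely many poles of `y` with `μ ≤ Σ_{P ∈ T} (-v_P(y))`. Then
`#S₂ + 2 #S₃ - μ - #T ≤ 2g - 2` (Riemann–Hurwitz with `e_P - 1 ≥ 1` on `S₂`, `≥ 2` on `S₃`,
`Σ_{poles}(e_P + 1) = μ + #T`). With `2 #S₂ ≥ μ - ν₂`, `3 #S₃ ≥ μ - ν₃`, `#T ≤ ν_∞` this is
`12 + μ - 3ν₂ - 4ν₃ - 6ν_∞ ≤ 12g`, the genus formula for `X₀(N)` as a lower bound.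
[cite: Stichtenoth2009, Cor. 3.5.5, Thm. 1.4.11] -/
theorem card_add_two_mul_card_le_genus (hrat : ∀ P : PlaceOver K F, P.IsRational) {y : F}
    (hy : y ∉ Set.range (algebraMap K F)) {a b : K} (hab : a ≠ b) (S₂ S₃ T : Finset (PlaceOver K F))
    (hS₂ : ∀ P ∈ S₂, y - algebraMap K F a ∈ P.ball 2) (hS₃ : ∀ P ∈ S₃, y - algebraMap K F b ∈ P.ball 3)
    (hT : ∀ P ∈ T, P.ord y < 0) {μ : ℤ} (hμ : (Module.finrank K⟮y⟯ F : ℤ) ≤ μ)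
    (hTμ : μ ≤ ∑ P ∈ T, -P.ord y) :
    (S₂.card : ℤ) + 2 * S₃.card - μ - T.card ≤ 2 * genus K F - 2 := by
  classical
  have hya : y ≠ algebraMap K F a := fun e ↦ hy ⟨a, e.symm⟩
  have hyb : y ≠ algebraMap K F b := fun e ↦ hy ⟨b, e.symm⟩
  -- places in `S₂`/`S₃` are finite for `y`, and the two sets are disjoint (`a ≠ b`)
  have memO : ∀ {P : PlaceOver K F} {c : K} {n : ℤ}, 1 ≤ n → y - algebraMap K F c ∈ P.ball n →
      y ∈ P.toValuationSubring := fun {P c n} hn hc ↦ by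
    have h0 : y - algebraMap K F c ∈ P.toValuationSubring :=
      (P.mem_ball_zero_iff _).1 (P.ball_antitone (show (0 : ℤ) ≤ n by omega) hc)
    simpa using add_mem h0 (P.algebraMap_mem c)
  have hdisj : Disjoint S₂ S₃ := Finset.disjoint_left.2 fun P h2 h3 ↦ hab <| by
    have h2' : y - algebraMap K F a ∈ P.ball 1 := P.ball_antitone (by norm_num) (hS₂ P h2)
    have h3' : y - algebraMap K F b ∈ P.ball 1 := P.ball_antitone (by norm_num) (hS₃ P h3)
    exact P.eq_of_sub_algebraMap_mem h2' h3'
  have hS : ∀ P ∈ S₂ ∪ S₃, 0 ≤ P.ord y := fun P hP ↦ by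
    have hy0 : y ≠ 0 := fun e ↦ hy ⟨0, by simp [e]⟩
    rcases Finset.mem_union.1 hP with h | h
    · exact (P.mem_toValuationSubring_iff_ord_nonneg hy0).1 (memO (by norm_num) (hS₂ P h))
    · exact (P.mem_toValuationSubring_iff_ord_nonneg hy0).1 (memO (by norm_num) (hS₃ P h))
  have hsum : (S₂.card : ℤ) + 2 * S₃.card ≤ ∑ P ∈ S₂ ∪ S₃, P.diffOrd y := by
    rw [Finset.sum_union hdisj]
    have h2 : (S₂.card : ℤ) ≤ ∑ P ∈ S₂, P.diffOrd y := by
      have : ∑ P ∈ S₂, (1 : ℤ) ≤ ∑ P ∈ S₂, P.diffOrd y := Finset.sum_le_sum fun P hP ↦ by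
        have := P.le_diffOrd_of_sub_algebraMap_mem (by norm_num) (hS₂ P hP) hya; omega
      simpa using this
    have h3 : 2 * (S₃.card : ℤ) ≤ ∑ P ∈ S₃, P.diffOrd y := by
      have : ∑ P ∈ S₃, (2 : ℤ) ≤ ∑ P ∈ S₃, P.diffOrd y := Finset.sum_le_sum fun P hP ↦ by
        have := P.le_diffOrd_of_sub_algebraMap_mem (by norm_num) (hS₃ P hP) hyb; omega
      simpa [mul_comm] using this
    linarith
  have key := sum_diffOrd_le hrat hy ((S₂ ∪ S₃) ∪ T) ?_
  · -- evaluate the `T`-part as in `le_genus_of_ramification`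
    have hyt : Transcendental K y := transcendental_of_not_mem_range hy
    have hdisj' : Disjoint (S₂ ∪ S₃) T := Finset.disjoint_left.2 fun P hPS hPT ↦ by
      have := hS P hPS; have := hT P hPT; omega
    rw [Finset.sum_union hdisj'] at key
    have hTsum : ∑ P ∈ T, P.diffOrd y = -(∑ P ∈ T, -P.ord y) - T.card := by
      rw [Finset.card_eq_sum_ones, Nat.cast_sum, Nat.cast_one, ← Finset.sum_neg_distrib,
        ← Finset.sum_sub_distrib]
      exact Finset.sum_congr rfl fun P hP ↦ by rw [P.diffOrd_of_ord_neg (hT P hP)]; ring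
    have hle := sum_neg_ord_le_finrank hrat hyt T hT
    rw [hTsum] at key
    linarith
  · intro P hP
    have hyt : Transcendental K y := transcendental_of_not_mem_range hy
    refine Finset.mem_union_right _ (mem_of_ord_neg hrat hyt T hT (hμ.trans hTμ) ?_)
    by_contra h
    exact hP (P.mem_toValuationSubring_of_ord_nonneg (not_lt.1 h))

/-- `card_add_two_mul_card_le_genus` as a dimension bound: with in addition an injective linear map
`L((dy)) → V` and natural numbers `ν₂, ν₃, ν_∞, γ` with `2 #S₂ + ν₂ ≥ μ`, `3 #S₃ + ν₃ ≥ μ`, `#T ≤ ν_∞` and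
`12 γ + 3ν₂ + 4ν₃ + 6ν_∞ ≤ 12 + μ` (for `X₀(N)`: the genus formula `twelve_mul_genusX0`), one gets
`γ ≤ dim_K V` (for `X₀(N)`: `genusX0 N ≤ dim S₂(Γ₀(N))`). [cite: Stichtenoth2009, Cor. 3.5.5, Cor. 1.5.16] -/
theorem le_finrank_of_cover₂₃ (hrat : ∀ P : PlaceOver K F, P.IsRational) {y : F}
    (hy : y ∉ Set.range (algebraMap K F)) {a b : K} (hab : a ≠ b) (S₂ S₃ T : Finset (PlaceOver K F))
    (hS₂ : ∀ P ∈ S₂, y - algebraMap K F a ∈ P.ball 2) (hS₃ : ∀ P ∈ S₃, y - algebraMap K F b ∈ P.ball 3)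
    (hT : ∀ P ∈ T, P.ord y < 0) {μ ν₂ ν₃ νi γ : ℕ} (hμ : Module.finrank K⟮y⟯ F ≤ μ)
    (hTμ : (μ : ℤ) ≤ ∑ P ∈ T, -P.ord y) (h₂ : μ ≤ 2 * S₂.card + ν₂) (h₃ : μ ≤ 3 * S₃.card + ν₃)
    (hi : T.card ≤ νi) (hγ : 12 * γ + 3 * ν₂ + 4 * ν₃ + 6 * νi ≤ 12 + μ)
    {V : Type*} [AddCommGroup V] [Module K V] [FiniteDimensional K V]
    (f : riemannRochSpace (differentialDivisor (dOf K y)) →ₗ[K] V) (hf : Function.Injective f) :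
    γ ≤ Module.finrank K V := by
  have h1 := card_add_two_mul_card_le_genus hrat hy hab S₂ S₃ T hS₂ hS₃ hT (Int.ofNat_le.2 hμ) hTμ
  have h2 := genus_le_finrank_of_injective hrat hy f hf
  have h3 : (γ : ℤ) ≤ genus K F := by omega
  exact (Int.ofNat_le.1 (by exact_mod_cast h3)).trans h2

end bounds

/-! ### Algebraically closed constant field of characteristic `0` -/

section algClosed

variable [IsAlgFunctionField K F]

/-- Over an algebraically closed constant field every place is rational (its residue field is a finite,
hence trivial, extension of `K`). [cite: Stichtenoth2009, Def. 1.1.14] -/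
theorem PlaceOver.isRational_of_isAlgClosed [IsAlgClosed K] (P : PlaceOver K F) : P.IsRational := by
  haveI : FiniteDimensional K P.residueField := PlaceOver.finiteDimensional_residueField_holds P
  haveI : Algebra.IsIntegral K P.residueField := Algebra.IsIntegral.of_finite K P.residueField
  have hbij := IsAlgClosed.algebraMap_bijective_of_isIntegral (k := K) (K := P.residueField)
  change Module.finrank K P.residueField = 1
  have e : K ≃ₗ[K] P.residueField :=
    LinearEquiv.ofBijective (Algebra.linearMap K P.residueField) hbij
  rw [← e.finrank_eq, Module.finrank_self]

omit [IsAlgFunctionField K F] in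
/-- An algebraically closed `K` is the full constant field of `F`. [folklore] -/
theorem isIntegrallyClosedIn_of_isAlgClosed [IsAlgClosed K] : IsIntegrallyClosedIn K F := by
  refine isIntegrallyClosedIn_iff.2 ⟨FaithfulSMul.algebraMap_injective K F, fun {x} hx ↦ ?_⟩
  have h : (minpoly K x).degree = 1 := IsAlgClosed.degree_eq_one_of_irreducible K (minpoly.irreducible hx)
  exact minpoly.mem_range_of_degree_eq_one K x h

/-- **The canonical divisor of `F/K` from a non-constant function** (`K` algebraically closed of
characteristic `0`): for `y ∈ F ∖ K`, the divisor `(dy)` satisfies `(dy)_P = v_P(y - y(P)) - 1` at the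
places where `y` is finite and `(dy)_P = v_P(y) - 1` at its poles, it is canonical, `deg (dy) = 2g - 2`,
`ℓ((dy)) = g`, and `Σ_P (dy)_P = 2g - 2` (**Riemann–Hurwitz** for `y : F → ℙ¹`: `2g - 2 = -2 deg y +
Σ_P (e_P - 1)`). [cite: Stichtenoth2009, Cor. 3.4.7, Thm. 3.5.1, Cor. 3.5.5] -/
theorem differentialDivisor_dOf_of_isAlgClosed [IsAlgClosed K] [CharZero K] {y : F}
    (hy : y ∉ Set.range (algebraMap K F)) :
    haveI := isIntegrallyClosedIn_of_isAlgClosed (K := K) (F := F)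
    (∀ P : PlaceOver K F, differentialDivisor (dOf K y) P = P.diffOrd y) ∧
      (differentialDivisor (dOf K y)).IsCanonical ∧
        (differentialDivisor (dOf K y)).degree = 2 * genus K F - 2 ∧
          ell (differentialDivisor (dOf K y)) = genus K F ∧
            ∑ᶠ P : PlaceOver K F, P.diffOrd y = 2 * genus K F - 2 := by
  haveI := isIntegrallyClosedIn_of_isAlgClosed (K := K) (F := F)
  have hrat : ∀ P : PlaceOver K F, P.IsRational := PlaceOver.isRational_of_isAlgClosed
  exact ⟨differentialDivisor_dOf_apply hrat hy, (isCanonical_differentialDivisor_dOf hrat hy).1,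
    (isCanonical_differentialDivisor_dOf hrat hy).2.1, (isCanonical_differentialDivisor_dOf hrat hy).2.2,
    finsum_diffOrd_eq hrat hy⟩

/-- **Packaged form over an algebraically closed constant field of characteristic `0`.** For
`y ∈ F ∖ K`, a finite set `S` of places outside of which `y` is finite with
`2γ - 2 ≤ Σ_{P ∈ S} diffOrd_P(y)`, and an injective `K`-linear map `L((dy)) → V`:
`γ ≤ g ≤ dim_K V`. (For `F = ℂ(X₀(N))`, `y = j`, `S` = cusps and the ramified points over
`j = 0, 1728`, `V = S₂(Γ₀(N))`: `genusX0 N ≤ dim S₂(Γ₀(N))`.) [cite: Stichtenoth2009, Cor. 3.5.5, Cor. 1.5.16] -/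
theorem le_finrank_of_le_sum_diffOrd_of_injective [IsAlgClosed K] [CharZero K] {y : F}
    (hy : y ∉ Set.range (algebraMap K F)) (S : Finset (PlaceOver K F))
    (hS : ∀ P : PlaceOver K F, y ∉ P.toValuationSubring → P ∈ S) {γ : ℤ}
    (hγ : 2 * γ - 2 ≤ ∑ P ∈ S, P.diffOrd y) {V : Type*} [AddCommGroup V] [Module K V]
    [FiniteDimensional K V]
    (f : haveI := isIntegrallyClosedIn_of_isAlgClosed (K := K) (F := F)
      riemannRochSpace (differentialDivisor (dOf K y)) →ₗ[K] V)
    (hf : Function.Injective f) : γ ≤ genus K F ∧ (genus K F : ℤ) ≤ Module.finrank K V := by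
  haveI := isIntegrallyClosedIn_of_isAlgClosed (K := K) (F := F)
  have hrat : ∀ P : PlaceOver K F, P.IsRational := PlaceOver.isRational_of_isAlgClosed
  exact ⟨le_genus_of_le_sum_diffOrd hrat hy S hS hγ,
    Int.ofNat_le.2 (genus_le_finrank_of_injective hrat hy f hf)⟩

/-- **Packaged form with explicit poles** (`K` algebraically closed of characteristic `0`): `y ∈ F ∖ K`;
`S` finitely many places where `y` is finite, with lower bounds for `diffOrd_P(y)` summed into
`Σ_{P ∈ S} diffOrd_P(y)`; `T` finitely many poles with `[F : K(y)] ≤ μ ≤ Σ_{P ∈ T} (-v_P(y))`; an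
injective linear map `L((dy)) → V`. Then `2γ - 2 ≤ Σ_{P ∈ S} diffOrd_P(y) - μ - #T ⇒ γ ≤ dim_K V`.
For `F = ℂ(X₀(N))`, `y = j`, `μ = [SL₂(ℤ) : Γ₀(N)]`, `T` = the `ν_∞` cusps (`-v_c(j) = ` width),
`S` = the non-elliptic points over `j = 1728` (`diffOrd = 1`) and `j = 0` (`diffOrd = 2`),
`V = S₂(Γ₀(N))`, `x ↦ x j′`: this is `genusX0 N ≤ dim S₂(Γ₀(N))`.
[cite: Stichtenoth2009, Cor. 3.5.5, Thm. 1.4.11, Cor. 1.5.16] -/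
theorem le_finrank_of_ramification_of_injective_of_isAlgClosed [IsAlgClosed K] [CharZero K] {y : F}
    (hy : y ∉ Set.range (algebraMap K F)) (S T : Finset (PlaceOver K F))
    (hS : ∀ P ∈ S, 0 ≤ P.ord y) (hT : ∀ P ∈ T, P.ord y < 0) {μ : ℤ}
    (hμ : (Module.finrank K⟮y⟯ F : ℤ) ≤ μ) (hTμ : μ ≤ ∑ P ∈ T, -P.ord y) {γ : ℤ}
    (hγ : 2 * γ - 2 ≤ (∑ P ∈ S, P.diffOrd y) - μ - T.card)
    {V : Type*} [AddCommGroup V] [Module K V] [FiniteDimensional K V]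
    (f : haveI := isIntegrallyClosedIn_of_isAlgClosed (K := K) (F := F)
      riemannRochSpace (differentialDivisor (dOf K y)) →ₗ[K] V)
    (hf : Function.Injective f) : γ ≤ Module.finrank K V := by
  haveI := isIntegrallyClosedIn_of_isAlgClosed (K := K) (F := F)
  exact le_finrank_of_ramification_of_injective PlaceOver.isRational_of_isAlgClosed hy S T hS hT hμ
    hTμ hγ f hf

/-- `le_finrank_of_cover₂₃` over an algebraically closed field of characteristic `0` (the form consumed
for `K = ℂ`, `F = ℂ(X₀(N))`, `y = j`, `a = 1728`, `b = 0`, `μ = [SL₂(ℤ) : Γ₀(N)]`, `S₂`/`S₃` the places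
at the non-elliptic points over `i`/`ρ`, `T` the cusps, `V = S₂(Γ₀(N))`, `γ = genusX0 N`).
[cite: Stichtenoth2009, Cor. 3.5.5, Cor. 1.5.16] -/
theorem le_finrank_of_cover₂₃_of_isAlgClosed [IsAlgClosed K] [CharZero K] {y : F}
    (hy : y ∉ Set.range (algebraMap K F)) {a b : K} (hab : a ≠ b) (S₂ S₃ T : Finset (PlaceOver K F))
    (hS₂ : ∀ P ∈ S₂, y - algebraMap K F a ∈ P.ball 2) (hS₃ : ∀ P ∈ S₃, y - algebraMap K F b ∈ P.ball 3)
    (hT : ∀ P ∈ T, P.ord y < 0) {μ ν₂ ν₃ νi γ : ℕ} (hμ : Module.finrank K⟮y⟯ F ≤ μ)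
    (hTμ : (μ : ℤ) ≤ ∑ P ∈ T, -P.ord y) (h₂ : μ ≤ 2 * S₂.card + ν₂) (h₃ : μ ≤ 3 * S₃.card + ν₃)
    (hi : T.card ≤ νi) (hγ : 12 * γ + 3 * ν₂ + 4 * ν₃ + 6 * νi ≤ 12 + μ)
    {V : Type*} [AddCommGroup V] [Module K V] [FiniteDimensional K V]
    (f : haveI := isIntegrallyClosedIn_of_isAlgClosed (K := K) (F := F)
      riemannRochSpace (differentialDivisor (dOf K y)) →ₗ[K] V)
    (hf : Function.Injective f) : γ ≤ Module.finrank K V := by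
  haveI := isIntegrallyClosedIn_of_isAlgClosed (K := K) (F := F)
  exact le_finrank_of_cover₂₃ PlaceOver.isRational_of_isAlgClosed hy hab S₂ S₃ T hS₂ hS₃ hT hμ hTμ h₂
    h₃ hi hγ f hf

/-- `le_finrank_of_complete_fibres` over an algebraically closed field of characteristic `0`.
[cite: Stichtenoth2009, Cor. 3.5.5, Cor. 1.5.16] -/
theorem le_finrank_of_complete_fibres_of_isAlgClosed [IsAlgClosed K] [CharZero K] {y : F}
    (hy : y ∉ Set.range (algebraMap K F)) {a b : K} (hab : a ≠ b) (Sa Sb T : Finset (PlaceOver K F))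
    (hSa : ∀ P : PlaceOver K F, 0 < P.ord (y - algebraMap K F a) → P ∈ Sa)
    (hSb : ∀ P : PlaceOver K F, 0 < P.ord (y - algebraMap K F b) → P ∈ Sb)
    (hT : ∀ P : PlaceOver K F, P.ord y < 0 → P ∈ T) {μ ν₂ ν₃ νi γ : ℕ}
    (hμ : μ ≤ Module.finrank K⟮y⟯ F) (h₂ : 2 * Sa.card ≤ μ + ν₂) (h₃ : 3 * Sb.card ≤ μ + 2 * ν₃)
    (hi : T.card ≤ νi) (hγ : 12 * γ + 3 * ν₂ + 4 * ν₃ + 6 * νi ≤ 12 + μ)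
    {V : Type*} [AddCommGroup V] [Module K V] [FiniteDimensional K V]
    (f : haveI := isIntegrallyClosedIn_of_isAlgClosed (K := K) (F := F)
      riemannRochSpace (differentialDivisor (dOf K y)) →ₗ[K] V)
    (hf : Function.Injective f) : γ ≤ Module.finrank K V := by
  haveI := isIntegrallyClosedIn_of_isAlgClosed (K := K) (F := F)
  exact le_finrank_of_complete_fibres PlaceOver.isRational_of_isAlgClosed hy hab Sa Sb T hSa hSb hT hμ
    h₂ h₃ hi hγ f hf

end algClosed

end Literature.NumberTheory.DiophantineGeometry.AlgFunctionField
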